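import Mathlib.LinearAlgebra.Matrix.SpecialLinearGroup
import Literature.NumberTheory.EllipticCurves.TateModuleBigImageOfSurjectiveProofs
import Literature.NumberTheory.GaloisRepresentations.CyclotomicCharacterSurjectiveProofs
import HarnessLib

/-!
# Kato 2004, condition (12.5.2) for the Tate module of an elliptic curve over `ℚ`, and its
# equivalence with surjectivity of `ρ_{E,p^∞} : Γ_ℚ → GL₂(ℤ_p)`

Topic `Literature/NumberTheory/EllipticCurves`; ONE definition (a predicate on `(W, p)` with a body —
nothing is asserted, no named fact) and theorems only.

K. Kato, *`p`-adic Hodge theory and values of zeta functions of modular forms*, Astérisque 295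
(2004) 117–290, Thm. 12.5 (4), p. 222, prints the hypothesis under which the INTEGRAL statements of
the volume hold (Thm. 12.5 (4) `Z(f,T) ⊂ H¹(T)` and the length inequality at every height-one prime;
Thm. 13.4 (3), p. 226; Thm. 14.5 (3), p. 236; Thm. 17.4 (3), p. 273, "assume further `p ≠ 2` and
that the condition (12.5.2) in 12.5 (4) is satisfied"):

> (12.5.2) There exists an `O_λ`-basis of `T` for which the image of the homomorphism
> `Gal(ℚ̄/ℚ(ζ_{p^∞})) → GL_{O_λ}(T) ≃ GL₂(O_λ)` contains `SL₂(ℤ_p)`. Here the last isomorphism is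
> given by this basis of `T`.

Here `T` is a `Gal(ℚ̄/ℚ)`-stable `O_λ`-lattice of `V_{F_λ}(f)`.  For the newform `f` of an elliptic
curve `E/ℚ` one has `F = ℚ`, `O_λ = ℤ_p`, and `V_{ℚ_p}(f) ≅ V_pE(-1)` (Kato 14.10, p. 241), so the
lattices are `T = T'(-1)` for `T' ⊆ V_pE` a stable `ℤ_p`-lattice, e.g. `T' = T_pE` (Kato 17.5,
p. 274: "In the case `f` of weight 2 and `T = (T_pE)(-1)` for an elliptic curve `E` over `ℚ`").  The
Tate twist is invisible in (12.5.2): the cyclotomic character is trivial on `Gal(ℚ̄/ℚ(ζ_{p^∞}))`,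
so `T_pE(-1)` and `T_pE` are the same representation of that group, with the same matrices in the
same basis.  `Kato2004.ImageContainsSL2 W p` below is (12.5.2) for `T = T_pE` (`W` a Weierstrass
model of `E`), word for word: a `ℤ_p`-basis `b` of `T_pE` (`W.tateModule p`) such that every
`M ∈ SL₂(ℤ_p)` is the matrix in `b` of `ρ_{E,p}(σ)` (`W.galoisRepTate p σ`) for some `σ ∈ Γ_ℚ` fixing
every `p`-power root of unity of `ℚ̄` (i.e. `σ ∈ Gal(ℚ̄/ℚ(ζ_{p^∞}))`).

The tree's Kato facts (`Literature.NumberTheory.EllipticCurves.kato_divisibility` clause (3),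
`PAdicBSD.lean`; the `Kato2004/BigImage…` files; `Wuthrich2014.…_of_surjective`) spell this
hypothesis instead as "`ρ̄_{E,p^n} : Γ_ℚ → Aut(E[p^n])` is onto for every `n`"
(`∀ n, W.HasSurjectiveModNGaloisRep (p ^ n)`), i.e. `ρ_{E,p^∞}(Γ_ℚ) = GL₂(ℤ_p)`.  This file PROVES
that the two hypotheses are EQUIVALENT for an elliptic curve over `ℚ`
(`Kato2004.imageContainsSL2_iff_forall_hasSurjectiveModNGaloisRep`):

* `⇐` (`Kato2004.imageContainsSL2_of_forall_hasSurjectiveModNGaloisRep`): levelwise surjectivity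
  gives, by compactness of `Γ_ℚ`, a `σ` realising any prescribed `ℤ_p`-linear automorphism `U` of
  `T_pE` (`WeierstrassCurve.exists_galoisRepTate_eq_of_forall_hasSurjectiveModNGaloisRep`, the
  argument of `TateModuleBigImageOfSurjectiveProofs` run for an arbitrary `U` instead of
  `(1 1; 0 1)`); if `det U = 1` then `χ_p(σ) = det ρ(σ) = 1` (`det ρ_{E,p} = χ_p`, Weil pairing,
  `det_galoisRepTate_eq_cyclotomicCharacter`), so `σ` fixes `μ_{p^∞}`.  This holds for EVERY basis.
* `⇒` (`Kato2004.forall_hasSurjectiveModNGaloisRep_of_imageContainsSL2`): an automorphism `φ` of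
  `E[p^n]` lifts to a `ℤ_p`-linear endomorphism `A` of `T_pE` with `π_n ∘ A = φ ∘ π_n` (lift the
  images of a basis; `π_n : T_pE → E[p^n]` is onto with kernel `p^n T_pE`), and `det A ∈ ℤ_pˣ`
  (`A` is invertible modulo `p^n`, `n ≥ 1`).  The cyclotomic character of `ℚ` is onto `ℤ_pˣ`
  (`GaloisRep.cyclotomicCharacter_surjective`, from the irreducibility of all cyclotomic
  polynomials over `ℚ`, Mathlib `Polynomial.cyclotomic.irreducible_rat`), so `det ρ(σ₁) = det A`
  for some `σ₁`; then `A ∘ ρ(σ₁)⁻¹` has determinant `1`, is `ρ(τ)` for some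
  `τ ∈ Gal(ℚ̄/ℚ(ζ_{p^∞}))` by (12.5.2), and `σ = τ σ₁` acts on `E[p^n]` as `φ`.

Consequently the surjectivity binder of the tree's Kato facts is exactly Kato's printed (12.5.2)
(neither stronger nor weaker) for elliptic curves over `ℚ`; Kato's remark after (12.8.1) (p. 223:
under (12.5.2) all stable lattices are `aT`, `a ∈ F_λˣ`) is, for `E/ℚ`, the statement that `E[p]`
irreducible forces every stable lattice of `V_pE` to be `p^k T_pE`.

Deliberately NOT here: any statement of Thms 12.5 / 13.4 / 14.5 / 17.4 themselves (see
`PAdicBSD.lean`, `KatoDivisibilitySkeletonProofs.lean`, `KatoDivisibilityIntegralSkeletonProofs.lean`);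
no new named fact (D-0026).

## References

* [Kato2004Asterisque] K. Kato, Astérisque 295 (2004): (12.5.2) and Thm. 12.5 (4) (p. 222);
  (12.8.1)–(12.8.2) and the remark between them (p. 223); Thm. 13.4 (3) (p. 226); Thm. 14.5 (3)
  (p. 236); 14.10 (p. 241); 17.5 (p. 274); Thm. 17.4 (3) (p. 273).
* [SerreAbelianLadic1968] J.-P. Serre, *Abelian `ℓ`-adic representations and elliptic curves*
  (1968), IV-18–IV-23 (the image of `ρ_{E,p^∞}`; `det = χ_p`).
* [SilvermanAEC2009] J. H. Silverman, *AEC*, III.§7–§8 (`T_pE ≅ ℤ_p²`, Weil pairing).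
-/

noncomputable section

open scoped Classical
open Field

namespace Literature.NumberTheory.EllipticCurves.TateModule

variable {A : Type*} [AddCommGroup A] {p : ℕ} [Fact p.Prime]

/-- `ker (T_p A → A[p^n]) = p^n T_p A`: an element of the Tate module whose `n`-th component
vanishes is divisible by `p ^ n` (iterate `TateModule.p_smul_div`). Private copy of
`TateModule.exists_eq_pow_smul_of_proj_eq_zero` of `KatzLatticeRationalTorsionProofs` (same
statement and proof; that module's imports are not wanted here). Silverman, *AEC*, III.§7.
[folklore] -/
private theorem proj_ker_eq_pow_smul_aux' (n : ℕ) (a : TateModule A p) (h : proj p n a = 0) :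
    ∃ b : TateModule A p, a = ((p : ℤ_[p]) ^ n) • b := by
  induction n generalizing a with
  | zero => exact ⟨a, by rw [pow_zero, one_smul]⟩
  | succ n ih =>
    have h1 : proj p 1 a = 0 := by
      rw [← pow_smul_proj_self_add n 1 a, h, smul_zero]
    have hb : proj p n (div a h1) = 0 := by rw [proj_div]; exact h
    obtain ⟨c, hc⟩ := ih (div a h1) hb
    refine ⟨c, ?_⟩
    rw [← p_smul_div a h1, hc, smul_smul, pow_succ']

/-- Two elements of `T_p A` with the same `n`-th component have the same `n`-th component after
applying any `ℤ_p`-linear map (`ker π_n = p^n T_p A` is stable). Silverman, *AEC*, III.§7.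
[folklore] -/
private theorem proj_linear_eq_of_proj_eq (n : ℕ) (L : TateModule A p →ₗ[ℤ_[p]] TateModule A p)
    (a a' : TateModule A p) (h : proj p n a = proj p n a') :
    proj p n (L a) = proj p n (L a') := by
  have h0 : proj p n (a - a') = 0 := by rw [map_sub, h, sub_self]
  obtain ⟨c, hc⟩ := proj_ker_eq_pow_smul_aux' n (a - a') h0
  have h1 : L a - L a' = ((p : ℤ_[p]) ^ n) • L c := by rw [← map_sub, hc, map_smul]
  rw [← sub_eq_zero, ← map_sub, h1, proj_pow_smul, pow_smul_proj]

end Literature.NumberTheory.EllipticCurves.TateModule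

namespace WeierstrassCurve

open Literature.NumberTheory.EllipticCurves Literature.NumberTheory.GaloisRepresentations

variable (W : WeierstrassCurve ℚ) [W.IsElliptic] (p : ℕ) [Fact p.Prime]

/-- **Levelwise surjectivity ⟹ `p`-adic surjectivity.**  For an elliptic curve `E = W/ℚ` and a
prime `p`, if `ρ̄_{E,p^n} : Γ_ℚ → Aut(E[p^n])` is onto for every `n`, then every `ℤ_p`-linear
automorphism `U` of `T_pE` is `ρ_{E,p}(σ)` for some `σ ∈ Γ_ℚ` (so `ρ_{E,p^∞}(Γ_ℚ) = Aut_{ℤ_p}(T_pE) ≅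
GL₂(ℤ_p)`).  Proof: `U` descends to automorphisms `φ_n` of `E[p^n] = T_pE/p^n` (`ker π_n = p^n T_pE`,
`π_n` onto); the sets `S_n = {σ | σ ≡ U on E[p^n]}` are closed, non-empty (hypothesis) and
decreasing, and `Γ_ℚ` is compact.  (The argument of
`exists_quotient_range_galoisRepTate_sub_one_equiv_of_forall_surjective`, there run for
`U = (1 1; 0 1)` only.)  This is the passage from the tree's levelwise spelling to the `p`-adic
image `ρ_{E,p^∞}(Γ_ℚ) ⊆ GL_{ℤ_p}(T_pE)` in which Kato's (12.5.2) is phrased (`T_pE = lim E[p^n]`,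
Silverman, *AEC*, III.§7, Prop. III.7.1; Serre (1968), IV-18).
[cite: Kato2004Asterisque, (12.5.2) in Thm. 12.5 (4) (p. 222); SilvermanAEC2009, Prop. III.7.1(a)] -/
theorem exists_galoisRepTate_eq_of_forall_hasSurjectiveModNGaloisRep
    (hsurj : ∀ n : ℕ, W.HasSurjectiveModNGaloisRep (p ^ n : ℕ))
    (U : W.tateModule p ≃ₗ[ℤ_[p]] W.tateModule p) :
    ∃ σ : absoluteGaloisGroup ℚ,
      (W.galoisRepTate p σ : W.tateModule p →ₗ[ℤ_[p]] W.tateModule p) = U := by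
  have hp : p.Prime := Fact.out
  set T := W.tateModule p
  -- the reduction maps `π n : T → E[p^n]`
  have hmem : ∀ (n : ℕ) (a : T), TateModule.proj p n a ∈ geomTorsion W (p ^ n : ℕ) :=
    fun n a => proj_tateModule_mem_geomTorsion W p n a
  have hπsurj : ∀ (n : ℕ) (P : geomTorsion W (p ^ n : ℕ)), ∃ a : T, TateModule.proj p n a = P := by
    intro n P
    exact proj_surjective_of_isAlgClosed_holds W p n P.2
  have hker : ∀ (n : ℕ) (L : T →ₗ[ℤ_[p]] T) (a a' : T),
      TateModule.proj p n a = TateModule.proj p n a' →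
        TateModule.proj p n (L a) = TateModule.proj p n (L a') :=
    fun n L a a' h => TateModule.proj_linear_eq_of_proj_eq n L a a' h
  -- the induced automorphisms `φ n` of `E[p^n]`
  have hφ : ∀ n : ℕ, ∃ φ : geomTorsion W (p ^ n : ℕ) ≃+ geomTorsion W (p ^ n : ℕ),
      ∀ a : T, (φ ⟨TateModule.proj p n a, hmem n a⟩ : geomPoints W) =
        TateModule.proj p n (U a) := by
    intro n
    choose lift hlift using hπsurj n
    let f : geomTorsion W (p ^ n : ℕ) → geomTorsion W (p ^ n : ℕ) :=
      fun P => ⟨TateModule.proj p n (U (lift P)), hmem n _⟩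
    have hf' : ∀ P : geomTorsion W (p ^ n : ℕ), (f P : geomPoints W) =
        TateModule.proj p n (U (lift P)) := fun P => rfl
    have hf : ∀ a : T, (f ⟨TateModule.proj p n a, hmem n a⟩ : geomPoints W) =
        TateModule.proj p n (U a) := by
      intro a
      rw [hf']
      exact hker n U.toLinearMap _ _ (hlift _)
    have hadd : ∀ P Q, f (P + Q) = f P + f Q := by
      intro P Q
      apply Subtype.ext
      have hPQ : TateModule.proj p n (lift P + lift Q) =
          ((P + Q : geomTorsion W (p ^ n : ℕ)) : geomPoints W) := by
        rw [map_add, hlift, hlift]; rfl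
      have := hker n U.toLinearMap (lift (P + Q)) (lift P + lift Q) (by rw [hlift, hPQ])
      rw [hf']
      change TateModule.proj p n (U.toLinearMap (lift (P + Q))) = _
      rw [this, map_add, map_add]
      rfl
    let g : geomTorsion W (p ^ n : ℕ) → geomTorsion W (p ^ n : ℕ) :=
      fun P => ⟨TateModule.proj p n (U.symm (lift P)), hmem n _⟩
    have hfg : ∀ P, f (g P) = P := by
      intro P
      apply Subtype.ext
      have h1 : (f (g P) : geomPoints W) = TateModule.proj p n (U (U.symm (lift P))) :=
        hker n U.toLinearMap _ _ (hlift _)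
      rw [h1, LinearEquiv.apply_symm_apply, hlift]
    have hgf : ∀ P, g (f P) = P := by
      intro P
      apply Subtype.ext
      have h1 : (g (f P) : geomPoints W) = TateModule.proj p n (U.symm (U (lift P))) :=
        hker n U.symm.toLinearMap _ _ (hlift _)
      rw [h1, LinearEquiv.symm_apply_apply, hlift]
    refine ⟨AddEquiv.mk ⟨f, g, hgf, hfg⟩ hadd, fun a => hf a⟩
  choose φ hφ using hφ
  -- Galois elements realising `φ n`
  have hσn : ∀ n : ℕ, ∃ σ : absoluteGaloisGroup ℚ,
      ∀ a : T, σ • TateModule.proj p n a = TateModule.proj p n (U a) := by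
    intro n
    obtain ⟨σ, hσ⟩ := hsurj n (Multiplicative.ofAdd (φ n))
    refine ⟨σ, fun a => ?_⟩
    have h1 : ((Multiplicative.toAdd (galoisRepTorsion W _ σ)) ⟨TateModule.proj p n a, hmem n a⟩ :
        geomPoints W) = σ • TateModule.proj p n a := rfl
    rw [← h1, hσ, toAdd_ofAdd, hφ]
  -- the closed sets `S n`
  let S : ℕ → Set (absoluteGaloisGroup ℚ) :=
    fun n => {σ | ∀ a : T, σ • TateModule.proj p n a = TateModule.proj p n (U a)}
  haveI : ContinuousSMul (absoluteGaloisGroup ℚ) (geomPoints W) := continuousSMul_geomPoints' W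
  have hSclosed : ∀ n, IsClosed (S n) := by
    intro n
    have : S n = ⋂ a : T, {σ | σ • TateModule.proj p n a = TateModule.proj p n (U a)} := by
      ext σ; simp [S]
    rw [this]
    refine isClosed_iInter fun a => ?_
    exact isClosed_eq (continuous_id.smul continuous_const) continuous_const
  have hSne : ∀ n, (S n).Nonempty := fun n => hσn n
  have hSmono : ∀ n, S (n + 1) ⊆ S n := by
    intro n σ hσ a
    have e1 : TateModule.proj p n a = p • TateModule.proj p (n + 1) a :=
      (TateModule.smul_proj_succ n a).symm
    have e2 : TateModule.proj p n (U a) = p • TateModule.proj p (n + 1) (U a) :=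
      (TateModule.smul_proj_succ n (U a)).symm
    rw [e1, e2, smul_comm, hσ a]
  haveI : CompactSpace (absoluteGaloisGroup ℚ) := inferInstance
  obtain ⟨σ, hσ⟩ := IsCompact.nonempty_iInter_of_sequence_nonempty_isCompact_isClosed S hSmono hSne
    (isClosed_univ.isCompact.of_isClosed_subset (hSclosed 0) (Set.subset_univ _)) hSclosed
  rw [Set.mem_iInter] at hσ
  refine ⟨σ, ?_⟩
  apply LinearMap.ext
  intro a
  rw [galoisRepTate_apply_apply, LinearEquiv.coe_coe]
  exact TateModule.ext fun n => by
    rw [TateModule.proj_smul_of_distribMulAction]; exact hσ n a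

/-- `det ρ_{E,p}(σ) = 1` forces `σ ∈ Gal(ℚ̄/ℚ(ζ_{p^∞}))`: `det ρ_{E,p} = χ_p` (Weil pairing;
`det_galoisRepTate_eq_cyclotomicCharacter`), and `χ_p(σ) = 1` means `σ ζ = ζ^1` for every `p`-power
root of unity `ζ` (`GaloisRep.cyclotomicCharacter_spec`); this is why the elements of determinant `1`
produced from (12.5.2) lie in `Gal(ℚ̄/ℚ(ζ_{p^∞}))`. Silverman, *AEC*, III.§8 (Weil pairing,
`∧² T_ℓE ≅ ℤ_ℓ(1)`); Serre (1968), I-3.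
[cite: SilvermanAEC2009, Prop. III.8.1 and Prop. III.8.3; Kato2004Asterisque, (12.5.2) in Thm. 12.5 (4) (p. 222)] -/
theorem smul_eq_self_of_det_galoisRepTate_eq_one (σ : absoluteGaloisGroup ℚ)
    (hdet : LinearMap.det (W.galoisRepTate p σ : W.tateModule p →ₗ[ℤ_[p]] W.tateModule p) = 1)
    (n : ℕ) (t : AlgebraicClosure ℚ) (ht : t ^ p ^ n = 1) : σ • t = t := by
  have hp : p.Prime := Fact.out
  have hp0 : (p : ℚ) ≠ 0 := Nat.cast_ne_zero.mpr hp.ne_zero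
  haveI : NeZero (p : ℚ) := ⟨hp0⟩
  have hχ : GaloisRep.cyclotomicCharacter ℚ p σ = 1 := by
    apply Units.ext
    rw [Units.val_one, ← det_galoisRepTate_eq_cyclotomicCharacter W p hp0
      (fun n => exists_weilPairing_holds W _) σ, hdet]
  have hspec := GaloisRep.cyclotomicCharacter_spec ℚ p (k := n) σ t ht
  rw [hχ] at hspec
  rw [hspec, Units.val_one, map_one]
  rcases Nat.eq_zero_or_pos n with rfl | hn
  · rw [pow_zero, pow_one] at ht
    rw [ht, one_pow]
  · haveI : Fact (1 < p ^ n) := ⟨Nat.one_lt_pow hn.ne' hp.one_lt⟩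
    rw [ZMod.val_one, pow_one]

/-! ### Lifting automorphisms of `E[p^n]` to `T_pE` -/

omit [W.IsElliptic] in
/-- Coordinates: for a `ℤ_p`-basis `b` of `T_pE` and a `ℤ_p`-linear `L`,
`π_n(L t) = ∑ᵢ (tᵢ mod p^n) · π_n(L bᵢ)` where `t = ∑ᵢ tᵢ bᵢ` (`π_n` is additive and
`π_n(x • a) = (x mod p^n) • π_n a`, `TateModule.proj_smul`). Silverman, *AEC*, III.§7. [folklore] -/
private theorem proj_apply_eq_sum_repr (b : Module.Basis (Fin 2) ℤ_[p] (W.tateModule p))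
    (L : W.tateModule p →ₗ[ℤ_[p]] W.tateModule p) (n : ℕ) (t : W.tateModule p) :
    TateModule.proj p n (L t) =
      ∑ i, (PadicInt.toZModPow n (b.repr t i)).val • TateModule.proj p n (L (b i)) := by
  conv_lhs => rw [← b.sum_repr t]
  simp only [map_sum, map_smul, TateModule.proj_smul]

/-- **Lifting.**  Every additive endomorphism `φ` of `E[p^n]` lifts to a `ℤ_p`-linear endomorphism
`A` of `T_pE` with `π_n ∘ A = φ ∘ π_n` (`T_pE` is free: send a basis vector `bᵢ` to any lift of
`φ(π_n bᵢ)`, lifts existing because `π_n : T_pE → E[p^n]` is onto over `ℚ̄`,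
`proj_surjective_of_isAlgClosed`). Silverman, *AEC*, III.§7. [folklore] -/
private theorem exists_linearMap_proj_eq (n : ℕ)
    (φ : geomTorsion W (p ^ n : ℕ) →+ geomTorsion W (p ^ n : ℕ)) :
    ∃ A : W.tateModule p →ₗ[ℤ_[p]] W.tateModule p, ∀ t : W.tateModule p,
      TateModule.proj p n (A t) =
        (φ ⟨TateModule.proj p n t, proj_tateModule_mem_geomTorsion W p n t⟩ : geomPoints W) := by
  have hp : p.Prime := Fact.out
  have hp0 : (p : ℚ) ≠ 0 := Nat.cast_ne_zero.mpr hp.ne_zero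
  haveI : Module.Free ℤ_[p] (W.tateModule p) := module_free_tateModule_holds W p
  haveI : Module.Finite ℤ_[p] (W.tateModule p) := module_finite_tateModule_holds W p
  set T := W.tateModule p
  let b : Module.Basis (Fin 2) ℤ_[p] T :=
    Module.finBasisOfFinrankEq ℤ_[p] T (finrank_tateModule_eq_two_holds W p hp0)
  have hmem : ∀ (n : ℕ) (a : T), TateModule.proj p n a ∈ geomTorsion W (p ^ n : ℕ) :=
    fun n a => proj_tateModule_mem_geomTorsion W p n a
  -- lifts of the images of the basis vectors
  have hlift : ∀ i : Fin 2, ∃ a : T, TateModule.proj p n a =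
      (φ ⟨TateModule.proj p n (b i), hmem n (b i)⟩ : geomPoints W) :=
    fun i => proj_surjective_of_isAlgClosed_holds W p n (φ _).2
  choose a ha using hlift
  refine ⟨b.constr ℤ_[p] a, fun t => ?_⟩
  rw [proj_apply_eq_sum_repr W p b (b.constr ℤ_[p] a) n t]
  simp only [Module.Basis.constr_basis, ha]
  -- the right-hand side, expanded in the same coordinates
  have key : (⟨TateModule.proj p n t, hmem n t⟩ : geomTorsion W (p ^ n : ℕ)) =
      ∑ i, (PadicInt.toZModPow n (b.repr t i)).val •
        (⟨TateModule.proj p n (b i), hmem n (b i)⟩ : geomTorsion W (p ^ n : ℕ)) := by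
    apply Subtype.ext
    rw [AddSubmonoidClass.coe_finsetSum]
    simp only [AddSubmonoidClass.coe_nsmul]
    have h := proj_apply_eq_sum_repr W p b LinearMap.id n t
    simpa using h
  rw [key, map_sum, AddSubmonoidClass.coe_finsetSum]
  simp only [map_nsmul, AddSubmonoidClass.coe_nsmul]

/-- In `ℤ_p`, `1 + p z` is a unit (`p z` lies in the maximal ideal). [folklore] -/
private theorem isUnit_one_add_p_mul (z : ℤ_[p]) : IsUnit (1 + (p : ℤ_[p]) * z) := by
  have hp : p.Prime := Fact.out
  have hmem : -((p : ℤ_[p]) * z) ∈ nonunits ℤ_[p] := by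
    rw [PadicInt.mem_nonunits, norm_neg, norm_mul, PadicInt.norm_p]
    have hz : ‖z‖ ≤ 1 := PadicInt.norm_le_one z
    have hp1 : ((p : ℝ))⁻¹ < 1 := inv_lt_one_of_one_lt₀ (by exact_mod_cast hp.one_lt)
    have hp2 : (0 : ℝ) < ((p : ℝ))⁻¹ := inv_pos.mpr (by exact_mod_cast hp.pos)
    nlinarith [norm_nonneg z]
  have h := IsLocalRing.isUnit_one_sub_self_of_mem_nonunits _ hmem
  rwa [sub_neg_eq_add] at h

/-- **Lifts of automorphisms have unit determinant** (`n ≥ 1`).  If `A` lifts an automorphism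
`φ` of `E[p^n]` and `A'` lifts `φ⁻¹`, then `A A' ≡ 1 (mod p^n)`, so `A A' = 1 + p^n X` and
`det A · det A' = det(1 + p^n X) ∈ 1 + pℤ_p` is a unit; hence `det A ∈ ℤ_pˣ`.
Silverman, *AEC*, III.§7. [folklore] -/
private theorem isUnit_det_of_proj_eq {n : ℕ} (hn : 0 < n)
    (φ : geomTorsion W (p ^ n : ℕ) ≃+ geomTorsion W (p ^ n : ℕ))
    (A A' : W.tateModule p →ₗ[ℤ_[p]] W.tateModule p)
    (hA : ∀ t : W.tateModule p, TateModule.proj p n (A t) =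
      (φ ⟨TateModule.proj p n t, proj_tateModule_mem_geomTorsion W p n t⟩ : geomPoints W))
    (hA' : ∀ t : W.tateModule p, TateModule.proj p n (A' t) =
      (φ.symm ⟨TateModule.proj p n t, proj_tateModule_mem_geomTorsion W p n t⟩ : geomPoints W)) :
    IsUnit (LinearMap.det A) := by
  have hp : p.Prime := Fact.out
  have hp0 : (p : ℚ) ≠ 0 := Nat.cast_ne_zero.mpr hp.ne_zero
  haveI : Module.Free ℤ_[p] (W.tateModule p) := module_free_tateModule_holds W p
  haveI : Module.Finite ℤ_[p] (W.tateModule p) := module_finite_tateModule_holds W p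
  set T := W.tateModule p
  let b : Module.Basis (Fin 2) ℤ_[p] T :=
    Module.finBasisOfFinrankEq ℤ_[p] T (finrank_tateModule_eq_two_holds W p hp0)
  have hmem : ∀ (n : ℕ) (a : T), TateModule.proj p n a ∈ geomTorsion W (p ^ n : ℕ) :=
    fun n a => proj_tateModule_mem_geomTorsion W p n a
  -- `A A' ≡ 1 (mod p^n T)`
  have hAA' : ∀ t : T, TateModule.proj p n ((A * A' - 1) t) = 0 := by
    intro t
    have h1 : (⟨TateModule.proj p n (A' t), hmem n (A' t)⟩ : geomTorsion W (p ^ n : ℕ)) =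
        φ.symm ⟨TateModule.proj p n t, hmem n t⟩ := Subtype.ext (hA' t)
    rw [LinearMap.sub_apply, Module.End.one_apply, Module.End.mul_apply, map_sub, hA (A' t), h1,
      AddEquiv.apply_symm_apply, sub_self]
  have hdiv : ∀ t : T, ∃ c : T, (A * A' - 1) t = ((p : ℤ_[p]) ^ n) • c :=
    fun t => TateModule.proj_ker_eq_pow_smul_aux' n _ (hAA' t)
  choose c hc using hdiv
  let X : T →ₗ[ℤ_[p]] T := b.constr ℤ_[p] fun i => c (b i)
  have hX : A * A' - 1 = ((p : ℤ_[p]) ^ n) • X := by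
    refine b.ext fun i => ?_
    rw [hc, LinearMap.smul_apply, Module.Basis.constr_basis]
  have hAA'X : A * A' = 1 + ((p : ℤ_[p]) ^ n) • X := by rw [← hX]; abel
  -- `det (1 + p^n X) = 1 + p z`
  obtain ⟨m, rfl⟩ : ∃ m, n = m + 1 := ⟨n - 1, by omega⟩
  set Y := LinearMap.toMatrix b b X with hY
  have hdet : LinearMap.det (A * A') =
      1 + (p : ℤ_[p]) * ((p : ℤ_[p]) ^ m * (Y 0 0 + Y 1 1) +
        (p : ℤ_[p]) ^ (2 * m + 1) * (Y 0 0 * Y 1 1 - Y 0 1 * Y 1 0)) := by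
    rw [hAA'X, ← LinearMap.det_toMatrix b, map_add, LinearMap.toMatrix_one, map_smul, ← hY,
      Matrix.det_fin_two]
    simp only [Matrix.add_apply, Matrix.one_apply_eq, Matrix.one_apply_ne (by decide : (0 : Fin 2) ≠ 1),
      Matrix.one_apply_ne (by decide : (1 : Fin 2) ≠ 0), Matrix.smul_apply, smul_eq_mul]
    ring
  have hunit : IsUnit (LinearMap.det (A * A')) := by
    rw [hdet]; exact isUnit_one_add_p_mul p _
  rw [map_mul] at hunit
  exact isUnit_of_mul_isUnit_left hunit

end WeierstrassCurve

namespace Literature.NumberTheory.EllipticCurves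

namespace Kato2004

open WeierstrassCurve Literature.NumberTheory.GaloisRepresentations

/-- **Kato's condition (12.5.2)** for the `p`-adic Tate module `T = T_pE` of `E = W/ℚ`
(K. Kato, Astérisque 295 (2004), Thm. 12.5 (4), p. 222, verbatim: "There exists an `O_λ`-basis of
`T` for which the image of the homomorphism `Gal(ℚ̄/ℚ(ζ_{p^∞})) → GL_{O_λ}(T) ≃ GL₂(O_λ)` contains
`SL₂(ℤ_p)`. Here the last isomorphism is given by this basis of `T`."; for an elliptic curve
`O_λ = ℤ_p` and Kato's lattice is `T_pE(-1)`, 17.5 p. 274, which has the same matrices as `T_pE`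
on `Gal(ℚ̄/ℚ(ζ_{p^∞}))`, see the module docstring): there is a `ℤ_p`-basis `b` of `T_pE` such
that every matrix `M ∈ SL₂(ℤ_p)` is the matrix in `b` of `ρ_{E,p}(σ)` for some `σ ∈ Γ_ℚ` which
fixes every `p`-power root of unity of `ℚ̄` (`σ ∈ Gal(ℚ̄/ℚ(ζ_{p^∞}))`).
A DEFINITION (predicate on `(W, p)`, explicit binders): nothing is asserted, there is no `_holds`;
it is EQUIVALENT to `∀ n, W.HasSurjectiveModNGaloisRep (p ^ n)`
(`imageContainsSL2_iff_forall_hasSurjectiveModNGaloisRep`).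
[cite: Kato2004Asterisque, (12.5.2) in Thm. 12.5 (4) (p. 222)] -/
def ImageContainsSL2 (W : WeierstrassCurve ℚ) (p : ℕ) [Fact p.Prime] : Prop :=
  ∃ b : Module.Basis (Fin 2) ℤ_[p] (W.tateModule p),
    ∀ M : Matrix.SpecialLinearGroup (Fin 2) ℤ_[p],
      ∃ σ : absoluteGaloisGroup ℚ,
        (∀ (n : ℕ) (t : AlgebraicClosure ℚ), t ^ p ^ n = 1 → σ • t = t) ∧
          LinearMap.toMatrix b b (W.galoisRepTate p σ) = (M : Matrix (Fin 2) (Fin 2) ℤ_[p])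

variable (W : WeierstrassCurve ℚ) [W.IsElliptic] (p : ℕ) [Fact p.Prime]

/-- **`ρ_{E,p^∞}` onto `GL₂(ℤ_p)` ⟹ (12.5.2), for EVERY basis.**  If `ρ̄_{E,p^n}` is onto for every
`n`, then for any `ℤ_p`-basis `b` of `T_pE` and any `M ∈ SL₂(ℤ_p)` there is
`σ ∈ Gal(ℚ̄/ℚ(ζ_{p^∞}))` whose matrix in `b` is `M`: realise the automorphism with matrix `M` by
`exists_galoisRepTate_eq_of_forall_hasSurjectiveModNGaloisRep`, and `det M = 1 = χ_p(σ)` makes `σ`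
fix `μ_{p^∞}` (`smul_eq_self_of_det_galoisRepTate_eq_one`).  Kato (2004), (12.5.2), p. 222; Serre
(1968), IV-18. [cite: Kato2004Asterisque, (12.5.2) in Thm. 12.5 (4) (p. 222)] -/
theorem exists_fixing_toMatrix_eq_of_forall_hasSurjectiveModNGaloisRep
    (hsurj : ∀ n : ℕ, W.HasSurjectiveModNGaloisRep (p ^ n : ℕ))
    (b : Module.Basis (Fin 2) ℤ_[p] (W.tateModule p)) (M : Matrix.SpecialLinearGroup (Fin 2) ℤ_[p]) :
    ∃ σ : absoluteGaloisGroup ℚ,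
      (∀ (n : ℕ) (t : AlgebraicClosure ℚ), t ^ p ^ n = 1 → σ • t = t) ∧
        LinearMap.toMatrix b b (W.galoisRepTate p σ) = (M : Matrix (Fin 2) (Fin 2) ℤ_[p]) := by
  -- the automorphism `U` of `T_pE` with matrix `M` in the basis `b`
  have hMunit : IsUnit ((M : Matrix (Fin 2) (Fin 2) ℤ_[p]).det) := by
    rw [M.det_coe]; exact isUnit_one
  have hLunit : IsUnit (Matrix.toLin b b (M : Matrix (Fin 2) (Fin 2) ℤ_[p])) := by
    rw [← LinearMap.isUnit_toMatrix_iff (v₁ := b), LinearMap.toMatrix_toLin,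
      Matrix.isUnit_iff_isUnit_det]
    exact hMunit
  let U : W.tateModule p ≃ₗ[ℤ_[p]] W.tateModule p :=
    LinearEquiv.ofIsUnitDet (v := b) (v' := b)
      (f := Matrix.toLin b b (M : Matrix (Fin 2) (Fin 2) ℤ_[p]))
      (by rw [LinearMap.toMatrix_toLin]; exact hMunit)
  have hU : (U : W.tateModule p →ₗ[ℤ_[p]] W.tateModule p) =
      Matrix.toLin b b (M : Matrix (Fin 2) (Fin 2) ℤ_[p]) := rfl
  obtain ⟨σ, hσ⟩ := exists_galoisRepTate_eq_of_forall_hasSurjectiveModNGaloisRep W p hsurj U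
  have hmat : LinearMap.toMatrix b b (W.galoisRepTate p σ) = (M : Matrix (Fin 2) (Fin 2) ℤ_[p]) := by
    rw [hσ, hU, LinearMap.toMatrix_toLin]
  refine ⟨σ, ?_, hmat⟩
  refine smul_eq_self_of_det_galoisRepTate_eq_one W p σ ?_
  rw [← LinearMap.det_toMatrix b, hmat, M.det_coe]

/-- **`ρ_{E,p^∞}` onto `GL₂(ℤ_p)` ⟹ Kato's (12.5.2).**  For an elliptic curve `E = W/ℚ`: if
`ρ̄_{E,p^n} : Γ_ℚ → Aut(E[p^n])` is onto for every `n` (the surjectivity binder of the tree's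
`kato_divisibility` (3) and of the `Kato2004/BigImage…` facts), then the image of
`Gal(ℚ̄/ℚ(ζ_{p^∞}))` in `GL_{ℤ_p}(T_pE) ≅ GL₂(ℤ_p)` contains `SL₂(ℤ_p)` (for the basis of
`T_pE ≅ ℤ_p²` given by `finrank_tateModule_eq_two`, Silverman III.7.1 — indeed for every basis).
Kato (2004), (12.5.2), p. 222. [cite: Kato2004Asterisque, (12.5.2) in Thm. 12.5 (4) (p. 222)] -/
theorem imageContainsSL2_of_forall_hasSurjectiveModNGaloisRep
    (hsurj : ∀ n : ℕ, W.HasSurjectiveModNGaloisRep (p ^ n : ℕ)) : ImageContainsSL2 W p := by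
  have hp : p.Prime := Fact.out
  have hp0 : (p : ℚ) ≠ 0 := Nat.cast_ne_zero.mpr hp.ne_zero
  haveI : Module.Free ℤ_[p] (W.tateModule p) := module_free_tateModule_holds W p
  haveI : Module.Finite ℤ_[p] (W.tateModule p) := module_finite_tateModule_holds W p
  let b : Module.Basis (Fin 2) ℤ_[p] (W.tateModule p) :=
    Module.finBasisOfFinrankEq ℤ_[p] (W.tateModule p) (finrank_tateModule_eq_two_holds W p hp0)
  exact ⟨b, fun M =>
    exists_fixing_toMatrix_eq_of_forall_hasSurjectiveModNGaloisRep W p hsurj b M⟩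

/-- **(12.5.2) ⟹ `p`-adic surjectivity.**  If the image of `Gal(ℚ̄/ℚ(ζ_{p^∞}))` contains
`SL₂(ℤ_p)` (Kato's (12.5.2) for `T_pE`), then every `ℤ_p`-linear endomorphism `A` of `T_pE` with
unit determinant is `ρ_{E,p}(σ)` for some `σ ∈ Γ_ℚ`: the cyclotomic character of `ℚ` is onto `ℤ_pˣ`
(`GaloisRep.cyclotomicCharacter_surjective`, all cyclotomic polynomials being irreducible over `ℚ`),
so `det ρ(σ₁) = χ_p(σ₁) = det A` for some `σ₁`, and `A ∘ ρ(σ₁⁻¹)` has determinant `1`, hence is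
`ρ(τ)` with `τ ∈ Gal(ℚ̄/ℚ(ζ_{p^∞}))`; take `σ = τ σ₁`.  Kato (2004), (12.5.2), p. 222; Serre (1968),
IV-18. [cite: Kato2004Asterisque, (12.5.2) in Thm. 12.5 (4) (p. 222)] -/
theorem exists_galoisRepTate_eq_of_imageContainsSL2 (h : ImageContainsSL2 W p)
    (A : W.tateModule p →ₗ[ℤ_[p]] W.tateModule p) (hA : IsUnit (LinearMap.det A)) :
    ∃ σ : absoluteGaloisGroup ℚ,
      (W.galoisRepTate p σ : W.tateModule p →ₗ[ℤ_[p]] W.tateModule p) = A := by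
  have hp : p.Prime := Fact.out
  have hp0 : (p : ℚ) ≠ 0 := Nat.cast_ne_zero.mpr hp.ne_zero
  obtain ⟨b, hb⟩ := h
  set T := W.tateModule p
  set ρ := W.galoisRepTate p with hρ
  -- `σ₁` with `χ_p(σ₁) = det A`
  have hirr : ∀ n : ℕ, 0 < n → Irreducible (Polynomial.cyclotomic n ℚ) :=
    fun n hn => Polynomial.cyclotomic.irreducible_rat hn
  obtain ⟨σ₁, hσ₁⟩ := GaloisRep.cyclotomicCharacter_surjective ℚ p hirr hA.unit
  have hdet₁ : LinearMap.det (ρ σ₁) = LinearMap.det A := by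
    rw [hρ, det_galoisRepTate_eq_cyclotomicCharacter W p hp0 (fun n => exists_weilPairing_holds W _) σ₁,
      hσ₁, IsUnit.unit_spec]
  -- `C = A ∘ ρ(σ₁⁻¹)` has determinant `1`
  have hinv : ρ σ₁⁻¹ * ρ σ₁ = 1 := by rw [← map_mul, inv_mul_cancel, map_one]
  have hinv' : ρ σ₁ * ρ σ₁⁻¹ = 1 := by rw [← map_mul, mul_inv_cancel, map_one]
  set C : T →ₗ[ℤ_[p]] T := A * ρ σ₁⁻¹ with hC
  have hdetC : LinearMap.det C = 1 := by
    have h1 : LinearMap.det (ρ σ₁) * LinearMap.det (ρ σ₁⁻¹) = 1 := by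
      rw [← map_mul, hinv', map_one]
    rw [hC, map_mul, ← hdet₁, h1]
  -- `C = ρ(τ)` with `τ ∈ Gal(ℚ̄/ℚ(ζ_{p^∞}))`
  let M : Matrix.SpecialLinearGroup (Fin 2) ℤ_[p] :=
    ⟨LinearMap.toMatrix b b C, by rw [LinearMap.det_toMatrix, hdetC]⟩
  obtain ⟨τ, -, hτ⟩ := hb M
  have hτC : (ρ τ : T →ₗ[ℤ_[p]] T) = C :=
    (LinearMap.toMatrix b b).injective (by rw [hτ])
  refine ⟨τ * σ₁, ?_⟩
  rw [map_mul, hτC, hC, mul_assoc, hinv, mul_one]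

omit [Fact p.Prime] in
/-- `E[1] = 0`, so every statement about `Aut(E[p^0])` is trivial. [folklore] -/
private theorem subsingleton_geomTorsion_one (W : WeierstrassCurve ℚ) :
    Subsingleton (geomTorsion W ((p ^ 0 : ℕ) : ℤ)) := by
  refine ⟨fun x y => Subtype.ext ?_⟩
  have h0 : ∀ z : geomTorsion W ((p ^ 0 : ℕ) : ℤ), (z : geomPoints W) = 0 := by
    intro z
    have hz : ((p ^ 0 : ℕ) : ℤ) • (z : geomPoints W) = 0 :=
      (Submodule.mem_torsionBy_iff (R := ℤ) _ _).mp z.2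
    change ((1 : ℕ) : ℤ) • (z : geomPoints W) = 0 at hz
    rwa [Nat.cast_one, one_smul] at hz
  have hx := h0 x
  have hy := h0 y
  rw [hx, hy]

/-- **Kato's (12.5.2) ⟹ `ρ̄_{E,p^n}` onto for every `n`.**  For an elliptic curve `E = W/ℚ`: if
the image of `Gal(ℚ̄/ℚ(ζ_{p^∞}))` in `GL_{ℤ_p}(T_pE) ≅ GL₂(ℤ_p)` contains `SL₂(ℤ_p)` for some basis,
then `ρ̄_{E,p^n} : Γ_ℚ → Aut(E[p^n])` is onto for every `n` (the tree's spelling of "`ρ_{E,p^∞}` is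
onto `GL₂(ℤ_p)`").  Proof: lift `φ ∈ Aut(E[p^n])` to `A ∈ End_{ℤ_p}(T_pE)` (`exists_linearMap_proj_eq`),
`det A ∈ ℤ_pˣ` (`isUnit_det_of_proj_eq`), and realise `A = ρ(σ)` by
`exists_galoisRepTate_eq_of_imageContainsSL2` (this is where the surjectivity of the cyclotomic
character of `ℚ` enters); then `σ` acts on `E[p^n] = π_n(T_pE)` as `φ`.  Kato (2004), (12.5.2),
p. 222; Serre (1968), IV-18. [cite: Kato2004Asterisque, (12.5.2) in Thm. 12.5 (4) (p. 222)] -/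
theorem forall_hasSurjectiveModNGaloisRep_of_imageContainsSL2 (h : ImageContainsSL2 W p) (n : ℕ) :
    W.HasSurjectiveModNGaloisRep (p ^ n : ℕ) := by
  intro φm
  rcases Nat.eq_zero_or_pos n with rfl | hn
  · -- `E[1] = 0`
    haveI := subsingleton_geomTorsion_one p W
    refine ⟨1, ?_⟩
    apply Multiplicative.toAdd.injective
    ext P
    exact congrArg Subtype.val (Subsingleton.elim _ _)
  set φ : geomTorsion W (p ^ n : ℕ) ≃+ geomTorsion W (p ^ n : ℕ) := Multiplicative.toAdd φm with hφ
  set T := W.tateModule p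
  have hmem : ∀ (n : ℕ) (a : T), TateModule.proj p n a ∈ geomTorsion W (p ^ n : ℕ) :=
    fun n a => proj_tateModule_mem_geomTorsion W p n a
  obtain ⟨A, hA⟩ := exists_linearMap_proj_eq W p n φ.toAddMonoidHom
  obtain ⟨A', hA'⟩ := exists_linearMap_proj_eq W p n φ.symm.toAddMonoidHom
  have hAu : IsUnit (LinearMap.det A) :=
    isUnit_det_of_proj_eq W p hn φ A A' (fun t => hA t) (fun t => hA' t)
  obtain ⟨σ, hσ⟩ := exists_galoisRepTate_eq_of_imageContainsSL2 W p h A hAu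
  refine ⟨σ, ?_⟩
  apply Multiplicative.toAdd.injective
  rw [← hφ]
  refine AddEquiv.ext fun P => Subtype.ext ?_
  obtain ⟨t, ht⟩ := proj_surjective_of_isAlgClosed_holds W p n P.2
  have hP : P = ⟨TateModule.proj p n t, hmem n t⟩ := Subtype.ext ht.symm
  have h1 : ((Multiplicative.toAdd (galoisRepTorsion W _ σ)) P : geomPoints W) =
      σ • (P : geomPoints W) := rfl
  rw [h1, hP]
  change σ • TateModule.proj p n t = ((φ.toAddMonoidHom ⟨TateModule.proj p n t, hmem n t⟩ :
    geomTorsion W (p ^ n : ℕ)) : geomPoints W)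
  rw [← hA t, ← hσ, galoisRepTate_apply_apply, TateModule.proj_smul_of_distribMulAction]

/-- **Kato's (12.5.2) for `T_pE` ⟺ `ρ_{E,p^∞}(Γ_ℚ) = GL₂(ℤ_p)`** (levelwise: `ρ̄_{E,p^n}` onto
for every `n`), for an elliptic curve `E = W/ℚ` and any prime `p`.  Hence the surjectivity
binder of the tree's Kato facts (`kato_divisibility` (3); `Kato2004/BigImage…`) is exactly the
printed hypothesis (12.5.2) of Kato's Thms 12.5 (4), 13.4 (3), 14.5 (3), 17.4 (3).
[cite: Kato2004Asterisque, (12.5.2) in Thm. 12.5 (4) (p. 222); Thm. 17.4 (3) (p. 273)] -/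
theorem imageContainsSL2_iff_forall_hasSurjectiveModNGaloisRep :
    ImageContainsSL2 W p ↔ ∀ n : ℕ, W.HasSurjectiveModNGaloisRep (p ^ n : ℕ) :=
  ⟨forall_hasSurjectiveModNGaloisRep_of_imageContainsSL2 W p,
    imageContainsSL2_of_forall_hasSurjectiveModNGaloisRep W p⟩

/-! ### Corollaries at a single level: (12.5.2) versus `ρ̄_{E,p}` onto, and (12.5.2) ⟹ (im) -/

/-- **(12.5.2) ⟹ `ρ̄_{E,p}` onto** (level `n = 1` of
`forall_hasSurjectiveModNGaloisRep_of_imageContainsSL2`).  Contrapositive: at a prime `p` where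
the mod-`p` representation is NOT surjective (e.g. the residual classes "irreducible but not
surjective", X9 / X10b of the rank-≤1 census), Kato's hypothesis (12.5.2) FAILS, so only the
rational clause Thm. 17.4 (2) of Kato applies there, not the integral clause (3).
[cite: Kato2004Asterisque, (12.5.2) in Thm. 12.5 (4) (p. 222); Thm. 17.4 (2)(3) (p. 273)] -/
theorem hasSurjectiveModNGaloisRep_of_imageContainsSL2 (h : ImageContainsSL2 W p) :
    W.HasSurjectiveModNGaloisRep p := by
  simpa using forall_hasSurjectiveModNGaloisRep_of_imageContainsSL2 W p h 1

/-- **`¬ ρ̄_{E,p}` onto ⟹ ¬ (12.5.2).** [cite: Kato2004Asterisque, (12.5.2) in Thm. 12.5 (4) (p. 222)] -/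
theorem not_imageContainsSL2_of_not_hasSurjectiveModNGaloisRep
    (h : ¬ W.HasSurjectiveModNGaloisRep p) : ¬ ImageContainsSL2 W p :=
  fun h' => h (hasSurjectiveModNGaloisRep_of_imageContainsSL2 W p h')

/-- **`ρ̄_{E,p}` onto and `p ≥ 5` ⟹ (12.5.2)** (Serre's lifting lemma: a closed subgroup of
`SL₂(ℤ_p)` mapping onto `SL₂(𝔽_p)` is `SL₂(ℤ_p)` for `p ≥ 5` — tree theorem
`serre_hasSurjectiveModNGaloisRep_pow_holds`, Serre, *Abelian ℓ-adic representations* (1968),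
IV-23 Lemma 3 — then `imageContainsSL2_of_forall_hasSurjectiveModNGaloisRep`).  At `p = 3` the
lifting lemma fails and (12.5.2) is the genuinely `3`-ADIC condition `∀ n, Surj(3^n)`.
[cite: Kato2004Asterisque, (12.5.2) in Thm. 12.5 (4) (p. 222); SerreAbelianLadic1968, Ch. IV §3.4 Lemma 3 (IV-23)] -/
theorem imageContainsSL2_of_hasSurjectiveModNGaloisRep (h5 : 5 ≤ p)
    (hsurj : W.HasSurjectiveModNGaloisRep p) : ImageContainsSL2 W p :=
  imageContainsSL2_of_forall_hasSurjectiveModNGaloisRep W p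
    (serre_hasSurjectiveModNGaloisRep_pow_holds W p h5 hsurj)

/-- **For `p ≥ 5`: Kato's (12.5.2) for `T_pE` ⟺ `ρ̄_{E,p}` is onto** — the census bit `surj(p)`
of the rank-≤1 residual classes is exactly Kato's integrality hypothesis at every prime `p ≥ 5`.
[cite: Kato2004Asterisque, (12.5.2) in Thm. 12.5 (4) (p. 222); SerreAbelianLadic1968, Ch. IV §3.4 Lemma 3 (IV-23)] -/
theorem imageContainsSL2_iff_hasSurjectiveModNGaloisRep (h5 : 5 ≤ p) :
    ImageContainsSL2 W p ↔ W.HasSurjectiveModNGaloisRep p :=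
  ⟨hasSurjectiveModNGaloisRep_of_imageContainsSL2 W p,
    imageContainsSL2_of_hasSurjectiveModNGaloisRep W p h5⟩

/-- **(12.5.2) ⟹ (im).**  Kato's (12.5.2) implies the hypothesis of his general Euler-system
theorem Thm. 13.4 (3), p. 226 — "there exists an element `σ` of `Gal(ℚ̄/ℚ(ζ_{p^∞}))` such that
`Coker(1 - σ : T → T)` is a free `O_L`-module of rank `1`" — which is hypothesis (im) of
Burungale–Castella–Skinner 2025 / Skinner 2016 §2.5 (b): via the equivalence with levelwise
surjectivity and the tree theorem
`exists_quotient_range_galoisRepTate_sub_one_equiv_of_forall_surjective` (`σ ↦ (1 1; 0 1)`).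
[cite: Kato2004Asterisque, (12.5.2) in Thm. 12.5 (4) (p. 222); Thm. 13.4 (3) (p. 226)] -/
theorem exists_quotient_range_sub_one_equiv_of_imageContainsSL2 (h : ImageContainsSL2 W p) :
    ∃ σ : absoluteGaloisGroup ℚ,
      (∀ (n : ℕ) (t : AlgebraicClosure ℚ), t ^ p ^ n = 1 → σ • t = t) ∧
        Nonempty (((W.tateModule p) ⧸ LinearMap.range (W.galoisRepTate p σ - 1)) ≃ₗ[ℤ_[p]] ℤ_[p]) :=
  exists_quotient_range_galoisRepTate_sub_one_equiv_of_forall_surjective W p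
    (forall_hasSurjectiveModNGaloisRep_of_imageContainsSL2 W p h)

end Kato2004

end Literature.NumberTheory.EllipticCurves

/-! ### Surjectivity modulo `p²` lifts to surjectivity modulo every `p^n` (`p` odd); (12.5.2) at `p = 3`

For `p ≥ 5` the tree has Serre's lifting lemma (`serre_hasSurjectiveModNGaloisRep_pow_holds`:
`ρ̄_{E,p}` onto ⟹ every `ρ̄_{E,p^n}` onto), so (12.5.2) is the census bit `surj(p)`
(`Kato2004.imageContainsSL2_iff_hasSurjectiveModNGaloisRep`).  At `p = 3` this fails: there are
curves with `ρ̄_{E,3}` onto and `ρ̄_{E,9}` not onto (N. D. Elkies, *Elliptic curves with 3-adic Galois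
representation surjective mod 3 but not mod 9*, arXiv:math/0612734 (2006), Abstract and §4 — all of
them additive at `3`; C. Wuthrich, Doc. Math. 19 (2014), Lemma 20, tree fact
`Wuthrich2014.lemma20_surjective_threeAdic_of_semistable`, excludes this at a semistable `3`), and
"`ρ̄_{ℓ^n}` surjective ⇏ `ρ̄_{ℓ^{n+1}}` surjective for `ℓ^n = 2, 3, 4`" (T. and V. Dokchitser,
Math. Z. 272 (2012) 961–964, Introduction).  One level higher the obstruction disappears for every
odd `p`: **if `ρ̄_{E,p²}` is onto then every `ρ̄_{E,p^n}` is onto**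
(`WeierstrassCurve.forall_hasSurjectiveModNGaloisRep_of_hasSurjectiveModNGaloisRep_sq`), because the
INDUCTIVE STEP of Serre's proof (J.-P. Serre, *Abelian `ℓ`-adic representations and elliptic curves*
(1968), IV-23, Lemma 3; S. Lang, *Elliptic Functions* (1987), Ch. 17 §4, p. 179: "We can now proceed
inductively, writing `s = 1 + ℓⁿu`, and take `y = 1 + ℓⁿ⁻¹u`") uses only `ℓ` odd — it is the tree
lemma `GaloisRepresentations.Serre1968.exists_pow_eq_one_add_of_one_le`
(`(1 + p^k w + p^{k+1} v)^p ≡ 1 + p^{k+1} w (mod p^{k+2})` for `k ≥ 1`, `p > 2`) — and only the BASE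
step `mod p ⟹ mod p²` needs `p ≥ 5`.  (The same remark in the language of reductive groups: A. Vasiu,
*Surjectivity criteria for p-adic representations*, Manuscripta Math. 112 (2003), §1.2.2: "Serre's
method … can be adapted to get that … it is enough to show that `K₂ = G(W₂(k))`".)

The proof is run `p`-adically, on `T_pE` with `ρ = ρ_{E,p} : Γ_ℚ → End_{ℤ_p}(T_pE)`
(`WeierstrassCurve.galoisRepTate`), congruences modulo `p^k` meaning `= … + p^k • C` in
`End_{ℤ_p}(T_pE)`:
(a) `ρ̄_{E,p^m}` onto ⟹ every `B ∈ End(T_pE)` with `det B ∈ ℤ_pˣ` is `≡ ρ(σ) (mod p^m)` for some `σ`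
  (`B` induces an automorphism of `E[p^m] = T_pE/p^m`; realise it by `σ`; `ker π_m = p^m T_pE`) —
  `WeierstrassCurve.exists_galoisRepTate_eq_add_smul_of_hasSurjectiveModNGaloisRep`;
(b) from (a) at `m = 2`: every `1 + p^k Z` (`k ≥ 1`, any `Z`) is `≡ ρ(τ) (mod p^{k+1})` — for `k = 1`
  because `det(1 + pZ) ∈ 1 + pℤ_p` is a unit, and `k → k + 1` by `ρ(τ^p) = ρ(τ)^p` and the displayed
  congruence;
(c) induction on `k ≥ 2`: if `ρ(σ) = B + p^k C` then `B = (1 + p^k Z) ρ(σ)` with `Z = -C ρ(σ)⁻¹`, and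
  (b) gives `τ` with `ρ(τσ) ≡ B (mod p^{k+1})`;
(d) back to level `n`: an automorphism `φ` of `E[p^n]` lifts to `A ∈ End(T_pE)` with `det A ∈ ℤ_pˣ`
  (`exists_linearMap_proj_eq`, `isUnit_det_of_proj_eq` above), `A ≡ ρ(σ) (mod p^n)` by (c), and
  `σ` acts on `E[p^n] = π_n(T_pE)` as `φ`.
Consequences: `Kato2004.imageContainsSL2_iff_hasSurjectiveModNGaloisRep_sq` — **for odd `p`, Kato's
(12.5.2) for `T_pE` ⟺ `ρ̄_{E,p²}` onto**; at `p = 3`: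
`Kato2004.imageContainsSL2_three_iff_hasSurjectiveModNGaloisRep_nine` ((12.5.2) ⟺ `surj(9)`, a
finite certificate, with NO hypothesis on the reduction at `3` — so also for the curves additive at
`3`, where Wuthrich's Lemma 20 is silent) and
`WeierstrassCurve.forall_hasSurjectiveModNGaloisRep_three_pow_of_nine` (the binder
`∀ n, Surj(3^n)` of the tree's `p = 3` Kato/Wuthrich readings from `surj(9)`). -/

namespace WeierstrassCurve

open Literature.NumberTheory.EllipticCurves Literature.NumberTheory.GaloisRepresentations

variable (W : WeierstrassCurve ℚ) [W.IsElliptic] (p : ℕ) [Fact p.Prime]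

/-- A `ℤ_p`-linear automorphism `U` of `T_pE` induces an additive automorphism `φ` of
`E[p^n] = π_n(T_pE)` with `φ ∘ π_n = π_n ∘ U` (`ker π_n = p^n T_pE` is `U`-stable, `π_n` onto over
`ℚ̄`).  The construction inside `exists_galoisRepTate_eq_of_forall_hasSurjectiveModNGaloisRep`, as a
lemma.  Silverman, *AEC*, III.§7. [folklore] -/
private theorem exists_addEquiv_proj_eq (U : W.tateModule p ≃ₗ[ℤ_[p]] W.tateModule p) (n : ℕ) :
    ∃ φ : geomTorsion W (p ^ n : ℕ) ≃+ geomTorsion W (p ^ n : ℕ),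
      ∀ a : W.tateModule p,
        (φ ⟨TateModule.proj p n a, proj_tateModule_mem_geomTorsion W p n a⟩ : geomPoints W) =
          TateModule.proj p n (U a) := by
  set T := W.tateModule p
  have hmem : ∀ (n : ℕ) (a : T), TateModule.proj p n a ∈ geomTorsion W (p ^ n : ℕ) :=
    fun n a => proj_tateModule_mem_geomTorsion W p n a
  have hπsurj : ∀ P : geomTorsion W (p ^ n : ℕ), ∃ a : T, TateModule.proj p n a = P :=
    fun P => proj_surjective_of_isAlgClosed_holds W p n P.2
  have hker : ∀ (L : T →ₗ[ℤ_[p]] T) (a a' : T),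
      TateModule.proj p n a = TateModule.proj p n a' →
        TateModule.proj p n (L a) = TateModule.proj p n (L a') :=
    fun L a a' h => TateModule.proj_linear_eq_of_proj_eq n L a a' h
  choose lift hlift using hπsurj
  let f : geomTorsion W (p ^ n : ℕ) → geomTorsion W (p ^ n : ℕ) :=
    fun P => ⟨TateModule.proj p n (U (lift P)), hmem n _⟩
  have hf' : ∀ P : geomTorsion W (p ^ n : ℕ), (f P : geomPoints W) =
      TateModule.proj p n (U (lift P)) := fun P => rfl
  have hf : ∀ a : T, (f ⟨TateModule.proj p n a, hmem n a⟩ : geomPoints W) =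
      TateModule.proj p n (U a) := by
    intro a
    rw [hf']
    exact hker U.toLinearMap _ _ (hlift _)
  have hadd : ∀ P Q, f (P + Q) = f P + f Q := by
    intro P Q
    apply Subtype.ext
    have hPQ : TateModule.proj p n (lift P + lift Q) =
        ((P + Q : geomTorsion W (p ^ n : ℕ)) : geomPoints W) := by
      rw [map_add, hlift, hlift]; rfl
    have := hker U.toLinearMap (lift (P + Q)) (lift P + lift Q) (by rw [hlift, hPQ])
    rw [hf']
    change TateModule.proj p n (U.toLinearMap (lift (P + Q))) = _
    rw [this, map_add, map_add]
    rfl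
  let g : geomTorsion W (p ^ n : ℕ) → geomTorsion W (p ^ n : ℕ) :=
    fun P => ⟨TateModule.proj p n (U.symm (lift P)), hmem n _⟩
  have hfg : ∀ P, f (g P) = P := by
    intro P
    apply Subtype.ext
    have h1 : (f (g P) : geomPoints W) = TateModule.proj p n (U (U.symm (lift P))) :=
      hker U.toLinearMap _ _ (hlift _)
    rw [h1, LinearEquiv.apply_symm_apply, hlift]
  have hgf : ∀ P, g (f P) = P := by
    intro P
    apply Subtype.ext
    have h1 : (g (f P) : geomPoints W) = TateModule.proj p n (U.symm (U (lift P))) :=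
      hker U.symm.toLinearMap _ _ (hlift _)
    rw [h1, LinearEquiv.symm_apply_apply, hlift]
  exact ⟨AddEquiv.mk ⟨f, g, hgf, hfg⟩ hadd, fun a => hf a⟩

/-- **(a) Surjectivity modulo `p^m`, read on `T_pE`.**  If `ρ̄_{E,p^m} : Γ_ℚ → Aut(E[p^m])` is onto,
then every `ℤ_p`-linear endomorphism `B` of `T_pE` with `det B ∈ ℤ_pˣ` is congruent modulo `p^m` to
some `ρ_{E,p}(σ)`: `ρ(σ) = B + p^m C` in `End_{ℤ_p}(T_pE)`.  (`B` is invertible, so it induces an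
automorphism of `E[p^m] = T_pE/p^m T_pE`; realise it by `σ`; then `ρ(σ) - B` kills `E[p^m]`, i.e. takes
values in `ker π_m = p^m T_pE`, and `T_pE` is free.)  Silverman, *AEC*, III.§7 (`T_pE = lim E[p^n]`,
Prop. III.7.1); Serre (1968), IV-18 (the image of `ρ_{E,p^∞}` and its reductions).
[cite: SilvermanAEC2009, Prop. III.7.1(a)] [cite: SerreAbelianLadic1968, Ch. IV §3.4 (IV-18–IV-23)] -/
theorem exists_galoisRepTate_eq_add_smul_of_hasSurjectiveModNGaloisRep {m : ℕ}
    (hsurj : W.HasSurjectiveModNGaloisRep (p ^ m : ℕ))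
    (B : W.tateModule p →ₗ[ℤ_[p]] W.tateModule p) (hB : IsUnit (LinearMap.det B)) :
    ∃ σ : absoluteGaloisGroup ℚ, ∃ C : W.tateModule p →ₗ[ℤ_[p]] W.tateModule p,
      (W.galoisRepTate p σ : W.tateModule p →ₗ[ℤ_[p]] W.tateModule p) =
        B + ((p : ℤ_[p]) ^ m) • C := by
  have hp : p.Prime := Fact.out
  have hp0 : (p : ℚ) ≠ 0 := Nat.cast_ne_zero.mpr hp.ne_zero
  haveI : Module.Free ℤ_[p] (W.tateModule p) := module_free_tateModule_holds W p
  haveI : Module.Finite ℤ_[p] (W.tateModule p) := module_finite_tateModule_holds W p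
  set T := W.tateModule p
  let b : Module.Basis (Fin 2) ℤ_[p] T :=
    Module.finBasisOfFinrankEq ℤ_[p] T (finrank_tateModule_eq_two_holds W p hp0)
  have hmem : ∀ (n : ℕ) (a : T), TateModule.proj p n a ∈ geomTorsion W (p ^ n : ℕ) :=
    fun n a => proj_tateModule_mem_geomTorsion W p n a
  -- `B` as a linear automorphism `U`
  have hBmat : IsUnit (LinearMap.toMatrix b b B).det := by
    rw [LinearMap.det_toMatrix]; exact hB
  let U : T ≃ₗ[ℤ_[p]] T := LinearEquiv.ofIsUnitDet (v := b) (v' := b) (f := B) hBmat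
  have hU : (U : T →ₗ[ℤ_[p]] T) = B := rfl
  -- the induced automorphism of `E[p^m]`, realised by some `σ`
  obtain ⟨φ, hφ⟩ := exists_addEquiv_proj_eq W p U m
  obtain ⟨σ, hσ⟩ := hsurj (Multiplicative.ofAdd φ)
  have hσa : ∀ a : T, σ • TateModule.proj p m a = TateModule.proj p m (B a) := by
    intro a
    have h1 : ((Multiplicative.toAdd (galoisRepTorsion W _ σ)) ⟨TateModule.proj p m a, hmem m a⟩ :
        geomPoints W) = σ • TateModule.proj p m a := rfl
    rw [← h1, hσ, toAdd_ofAdd, hφ, ← hU]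
    rfl
  -- `ρ(σ) - B` takes values in `p^m T_pE`
  have hdiff : ∀ t : T, TateModule.proj p m ((W.galoisRepTate p σ - B) t) = 0 := by
    intro t
    rw [LinearMap.sub_apply, map_sub, galoisRepTate_apply_apply,
      TateModule.proj_smul_of_distribMulAction, hσa t, sub_self]
  have hdiv : ∀ t : T, ∃ c : T, (W.galoisRepTate p σ - B) t = ((p : ℤ_[p]) ^ m) • c :=
    fun t => TateModule.proj_ker_eq_pow_smul_aux' m _ (hdiff t)
  choose c hc using hdiv
  let C : T →ₗ[ℤ_[p]] T := b.constr ℤ_[p] fun i => c (b i)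
  have hC : W.galoisRepTate p σ - B = ((p : ℤ_[p]) ^ m) • C := by
    refine b.ext fun i => ?_
    rw [hc, LinearMap.smul_apply, Module.Basis.constr_basis]
  exact ⟨σ, C, by rw [← hC]; abel⟩

/-- `det(1 + pZ) ∈ 1 + pℤ_p` is a unit, for any `ℤ_p`-linear `Z` on `T_pE` (expand the `2 × 2`
determinant in a basis). [folklore] -/
private theorem isUnit_det_one_add_p_smul (Z : W.tateModule p →ₗ[ℤ_[p]] W.tateModule p) :
    IsUnit (LinearMap.det (1 + (p : ℤ_[p]) • Z)) := by
  have hp : p.Prime := Fact.out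
  have hp0 : (p : ℚ) ≠ 0 := Nat.cast_ne_zero.mpr hp.ne_zero
  haveI : Module.Free ℤ_[p] (W.tateModule p) := module_free_tateModule_holds W p
  haveI : Module.Finite ℤ_[p] (W.tateModule p) := module_finite_tateModule_holds W p
  set T := W.tateModule p
  let b : Module.Basis (Fin 2) ℤ_[p] T :=
    Module.finBasisOfFinrankEq ℤ_[p] T (finrank_tateModule_eq_two_holds W p hp0)
  set Y := LinearMap.toMatrix b b Z with hY
  have hdet : LinearMap.det (1 + (p : ℤ_[p]) • Z) =
      1 + (p : ℤ_[p]) * ((Y 0 0 + Y 1 1) + (p : ℤ_[p]) * (Y 0 0 * Y 1 1 - Y 0 1 * Y 1 0)) := by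
    rw [← LinearMap.det_toMatrix b, map_add, LinearMap.toMatrix_one, map_smul, ← hY,
      Matrix.det_fin_two]
    simp only [Matrix.add_apply, Matrix.one_apply_eq, Matrix.one_apply_ne (by decide : (0 : Fin 2) ≠ 1),
      Matrix.one_apply_ne (by decide : (1 : Fin 2) ≠ 0), Matrix.smul_apply, smul_eq_mul]
    ring
  rw [hdet]
  exact isUnit_one_add_p_mul p _

/-- **(b) The kernel elements.**  If `p` is odd and `ρ̄_{E,p²}` is onto, then for every `k ≥ 1` and
every `ℤ_p`-linear `Z` on `T_pE` there is `τ ∈ Γ_ℚ` with `ρ(τ) ≡ 1 + p^k Z (mod p^{k+1})`.  For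
`k = 1`: `1 + pZ` has unit determinant, so (a) applies at level `p²`.  For `k → k + 1`:
`ρ(τ^p) = ρ(τ)^p` and `(1 + p^k Z + p^{k+1} V)^p ≡ 1 + p^{k+1} Z (mod p^{k+2})` (`p > 2`, `k ≥ 1`;
Serre 1968 IV-23 / Lang 1987 p. 179, the inductive step: tree lemma
`Serre1968.exists_pow_eq_one_add_of_one_le`).
[cite: SerreAbelianLadic1968, Ch. IV §3.4, Lemma 3 (IV-23), proof] [cite: Lang1987, Ch. 17 §4, proof of the Lemma (p. 179)] -/
private theorem exists_galoisRepTate_eq_one_add_pow_smul (hp2 : p ≠ 2)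
    (h2 : W.HasSurjectiveModNGaloisRep (p ^ 2 : ℕ)) {k : ℕ} (hk : 1 ≤ k)
    (Z : W.tateModule p →ₗ[ℤ_[p]] W.tateModule p) :
    ∃ τ : absoluteGaloisGroup ℚ, ∃ V : W.tateModule p →ₗ[ℤ_[p]] W.tateModule p,
      (W.galoisRepTate p τ : W.tateModule p →ₗ[ℤ_[p]] W.tateModule p) =
        1 + ((p : ℤ_[p]) ^ k) • Z + ((p : ℤ_[p]) ^ (k + 1)) • V := by
  have hp : p.Prime := Fact.out
  have hp3 : 2 < p := lt_of_le_of_ne hp.two_le (Ne.symm hp2)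
  induction k, hk using Nat.le_induction with
  | base =>
    obtain ⟨σ, C, hσ⟩ := exists_galoisRepTate_eq_add_smul_of_hasSurjectiveModNGaloisRep W p h2
      (1 + (p : ℤ_[p]) • Z) (isUnit_det_one_add_p_smul W p Z)
    exact ⟨σ, C, by rw [hσ, pow_one]⟩
  | succ k hk ih =>
    obtain ⟨τ, V, hτ⟩ := ih
    obtain ⟨V', hV'⟩ := Serre1968.exists_pow_eq_one_add_of_one_le
      (R := ℤ_[p]) (A := W.tateModule p →ₗ[ℤ_[p]] W.tateModule p) hp hp3 hk Z V
    refine ⟨τ ^ p, V', ?_⟩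
    rw [map_pow, hτ, hV']

/-- **Surjectivity modulo `p²` lifts to surjectivity modulo `p^n`, for odd `p`.**  For an elliptic
curve `E = W/ℚ` and an odd prime `p`: if `ρ̄_{E,p²} : Γ_ℚ → Aut(E[p²])` is onto, then
`ρ̄_{E,p^n} : Γ_ℚ → Aut(E[p^n])` is onto for every `n` (i.e. `ρ_{E,p^∞}(Γ_ℚ) = GL₂(ℤ_p)`).  This is
the inductive half of Serre's Lemma 3 (Serre 1968, IV-23; Lang 1987, Ch. 17 §4, p. 179), which uses
only `p` odd; the base step `mod p ⟹ mod p²` is where `p ≥ 5` is needed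
(`serre_hasSurjectiveModNGaloisRep_pow_holds`) and where `p = 3` fails (Elkies 2006; Dokchitser–
Dokchitser 2012, Introduction: lifting fails exactly for `ℓ^n ∈ {2, 3, 4}`).  Proof: steps (a)–(d) of
the section docstring.
[cite: SerreAbelianLadic1968, Ch. IV §3.4, Lemma 3 (IV-23)] [cite: Lang1987, Ch. 17 §4, Lemma and proof (pp. 178–179)] -/
theorem forall_hasSurjectiveModNGaloisRep_of_hasSurjectiveModNGaloisRep_sq (hp2 : p ≠ 2)
    (h2 : W.HasSurjectiveModNGaloisRep (p ^ 2 : ℕ)) (n : ℕ) :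
    W.HasSurjectiveModNGaloisRep (p ^ n : ℕ) := by
  have hp : p.Prime := Fact.out
  set T := W.tateModule p
  set ρ := W.galoisRepTate p with hρ
  -- (c) every `B` with unit determinant is `≡ ρ(σ) (mod p^k)`, for every `k ≥ 2`
  have key : ∀ k : ℕ, 2 ≤ k → ∀ B : T →ₗ[ℤ_[p]] T, IsUnit (LinearMap.det B) →
      ∃ σ : absoluteGaloisGroup ℚ, ∃ C : T →ₗ[ℤ_[p]] T,
        (ρ σ : T →ₗ[ℤ_[p]] T) = B + ((p : ℤ_[p]) ^ k) • C := by
    intro k hk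
    induction k, hk using Nat.le_induction with
    | base =>
      intro B hB
      exact exists_galoisRepTate_eq_add_smul_of_hasSurjectiveModNGaloisRep W p h2 B hB
    | succ k hk ih =>
      intro B hB
      obtain ⟨σ, C, hσ⟩ := ih B hB
      have hinv : ρ σ⁻¹ * ρ σ = 1 := by rw [← map_mul, inv_mul_cancel, map_one]
      set Z : T →ₗ[ℤ_[p]] T := -(C * ρ σ⁻¹) with hZ
      obtain ⟨τ, V, hτ⟩ :=
        exists_galoisRepTate_eq_one_add_pow_smul W p hp2 h2 (show 1 ≤ k by omega) Z
      refine ⟨τ * σ, V * ρ σ, ?_⟩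
      have hB' : B = ρ σ - ((p : ℤ_[p]) ^ k) • C := by rw [hσ]; abel
      rw [map_mul, hτ, hB', hZ, add_mul, add_mul, one_mul, smul_mul_assoc, smul_mul_assoc, neg_mul,
        mul_assoc, hinv, mul_one, pow_succ, mul_smul, smul_neg]
      abel
  -- the same modulo `p^n` for every `n ≥ 1` (for `n = 1` from the level `p²`)
  have key' : 1 ≤ n → ∀ B : T →ₗ[ℤ_[p]] T, IsUnit (LinearMap.det B) →
      ∃ σ : absoluteGaloisGroup ℚ, ∃ C : T →ₗ[ℤ_[p]] T,
        (ρ σ : T →ₗ[ℤ_[p]] T) = B + ((p : ℤ_[p]) ^ n) • C := by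
    intro hn B hB
    by_cases h1 : n = 1
    · subst h1
      obtain ⟨σ, C, hσ⟩ := exists_galoisRepTate_eq_add_smul_of_hasSurjectiveModNGaloisRep W p h2 B hB
      exact ⟨σ, (p : ℤ_[p]) • C, by rw [hσ, pow_one, smul_smul, ← pow_two]⟩
    · exact key n (by omega) B hB
  -- (d) back to `E[p^n]`
  intro φm
  rcases Nat.eq_zero_or_pos n with rfl | hn
  · -- `E[1] = 0`
    have h0 : ∀ z : geomTorsion W ((p ^ 0 : ℕ) : ℤ), (z : geomPoints W) = 0 := by
      intro z
      have hz : ((p ^ 0 : ℕ) : ℤ) • (z : geomPoints W) = 0 :=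
        (Submodule.mem_torsionBy_iff (R := ℤ) _ _).mp z.2
      change ((1 : ℕ) : ℤ) • (z : geomPoints W) = 0 at hz
      rwa [Nat.cast_one, one_smul] at hz
    haveI : Subsingleton (geomTorsion W ((p ^ 0 : ℕ) : ℤ)) :=
      ⟨fun x y => Subtype.ext (by rw [h0 x, h0 y])⟩
    refine ⟨1, ?_⟩
    apply Multiplicative.toAdd.injective
    ext P
    exact congrArg Subtype.val (Subsingleton.elim _ _)
  set φ : geomTorsion W (p ^ n : ℕ) ≃+ geomTorsion W (p ^ n : ℕ) := Multiplicative.toAdd φm with hφ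
  have hmem : ∀ (n : ℕ) (a : T), TateModule.proj p n a ∈ geomTorsion W (p ^ n : ℕ) :=
    fun n a => proj_tateModule_mem_geomTorsion W p n a
  obtain ⟨A, hA⟩ := exists_linearMap_proj_eq W p n φ.toAddMonoidHom
  obtain ⟨A', hA'⟩ := exists_linearMap_proj_eq W p n φ.symm.toAddMonoidHom
  have hAu : IsUnit (LinearMap.det A) :=
    isUnit_det_of_proj_eq W p hn φ A A' (fun t => hA t) (fun t => hA' t)
  obtain ⟨σ, C, hσ⟩ := key' hn A hAu
  refine ⟨σ, ?_⟩
  apply Multiplicative.toAdd.injective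
  rw [← hφ]
  refine AddEquiv.ext fun P => Subtype.ext ?_
  obtain ⟨t, ht⟩ := proj_surjective_of_isAlgClosed_holds W p n P.2
  have hP : P = ⟨TateModule.proj p n t, hmem n t⟩ := Subtype.ext ht.symm
  have h1 : ((Multiplicative.toAdd (galoisRepTorsion W _ σ)) P : geomPoints W) =
      σ • (P : geomPoints W) := rfl
  rw [h1, hP]
  change σ • TateModule.proj p n t = ((φ.toAddMonoidHom ⟨TateModule.proj p n t, hmem n t⟩ :
    geomTorsion W (p ^ n : ℕ)) : geomPoints W)
  have hσt : TateModule.proj p n (ρ σ t) = TateModule.proj p n (A t) := by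
    rw [hσ, LinearMap.add_apply, LinearMap.smul_apply, map_add, TateModule.proj_pow_smul,
      TateModule.pow_smul_proj, add_zero]
  rw [← hA t, ← hσt, hρ, galoisRepTate_apply_apply, TateModule.proj_smul_of_distribMulAction]

/-- **For odd `p`: `ρ̄_{E,p²}` onto ⟺ every `ρ̄_{E,p^n}` onto** (`⇐` is the case `n = 2`).
[cite: SerreAbelianLadic1968, Ch. IV §3.4, Lemma 3 (IV-23)] -/
theorem forall_hasSurjectiveModNGaloisRep_iff_hasSurjectiveModNGaloisRep_sq (hp2 : p ≠ 2) :
    (∀ n : ℕ, W.HasSurjectiveModNGaloisRep (p ^ n : ℕ)) ↔ W.HasSurjectiveModNGaloisRep (p ^ 2 : ℕ) :=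
  ⟨fun h => h 2, forall_hasSurjectiveModNGaloisRep_of_hasSurjectiveModNGaloisRep_sq W p hp2⟩

omit [Fact p.Prime] in
/-- **At `p = 3`: `ρ̄_{E,9}` onto ⟹ `ρ̄_{E,3^n}` onto for every `n`** — the binder "`∀ n, Surj(3^n)`"
of the tree's `p = 3` readings of Kato Thm. 17.4 (3) / Wuthrich Thm. 3 (`Kato2004/…CyclotomicThree…`,
`Wuthrich2014/…CyclotomicThree…`, `kato_divisibility` (3) at `p = 3`) from the finite certificate
`surj(9)`, with NO hypothesis on the reduction at `3` (Wuthrich 2014 Lemma 20 supplies the binder from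
`surj(3)` only at a semistable `3`; at an additive `3` the mod-`9` level is genuinely needed, Elkies
2006). [cite: SerreAbelianLadic1968, Ch. IV §3.4, Lemma 3 (IV-23)] -/
theorem forall_hasSurjectiveModNGaloisRep_three_pow_of_nine (W : WeierstrassCurve ℚ) [W.IsElliptic]
    (h9 : W.HasSurjectiveModNGaloisRep 9) (n : ℕ) : W.HasSurjectiveModNGaloisRep (3 ^ n : ℕ) := by
  haveI : Fact (Nat.Prime 3) := ⟨Nat.prime_three⟩
  have h2 : W.HasSurjectiveModNGaloisRep (3 ^ 2 : ℕ) := by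
    rw [show ((3 ^ 2 : ℕ) : ℤ) = 9 by norm_num]; exact h9
  exact forall_hasSurjectiveModNGaloisRep_of_hasSurjectiveModNGaloisRep_sq W 3 (by norm_num) h2 n

end WeierstrassCurve

namespace Literature.NumberTheory.EllipticCurves

namespace Kato2004

open WeierstrassCurve Literature.NumberTheory.GaloisRepresentations

variable (W : WeierstrassCurve ℚ) [W.IsElliptic] (p : ℕ) [Fact p.Prime]

/-- **`ρ̄_{E,p²}` onto and `p` odd ⟹ (12.5.2).** [cite: Kato2004Asterisque, (12.5.2) in Thm. 12.5 (4) (p. 222); SerreAbelianLadic1968, Ch. IV §3.4 Lemma 3 (IV-23)] -/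
theorem imageContainsSL2_of_hasSurjectiveModNGaloisRep_sq (hp2 : p ≠ 2)
    (h2 : W.HasSurjectiveModNGaloisRep (p ^ 2 : ℕ)) : ImageContainsSL2 W p :=
  imageContainsSL2_of_forall_hasSurjectiveModNGaloisRep W p
    (forall_hasSurjectiveModNGaloisRep_of_hasSurjectiveModNGaloisRep_sq W p hp2 h2)

/-- **For odd `p`: Kato's (12.5.2) for `T_pE` ⟺ `ρ̄_{E,p²}` is onto.**  Together with
`imageContainsSL2_iff_hasSurjectiveModNGaloisRep` (`p ≥ 5`: ⟺ `ρ̄_{E,p}` onto) this makes the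
integrality hypothesis of Kato's Thms 12.5 (4), 13.4 (3), 14.5 (3), 17.4 (3) a FINITE-LEVEL condition
at every odd prime: level `p` for `p ≥ 5`, level `9` for `p = 3`.
[cite: Kato2004Asterisque, (12.5.2) in Thm. 12.5 (4) (p. 222); SerreAbelianLadic1968, Ch. IV §3.4 Lemma 3 (IV-23)] -/
theorem imageContainsSL2_iff_hasSurjectiveModNGaloisRep_sq (hp2 : p ≠ 2) :
    ImageContainsSL2 W p ↔ W.HasSurjectiveModNGaloisRep (p ^ 2 : ℕ) :=
  ⟨fun h => forall_hasSurjectiveModNGaloisRep_of_imageContainsSL2 W p h 2,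
    imageContainsSL2_of_hasSurjectiveModNGaloisRep_sq W p hp2⟩

/-- **At `p = 3`: Kato's (12.5.2) for `T_3E` ⟺ `ρ̄_{E,9} : Γ_ℚ → Aut(E[9]) ≅ GL₂(ℤ/9)` is onto**
— for every elliptic curve over `ℚ`, whatever its reduction at `3`.  (At a semistable `3`,
Wuthrich 2014 Lemma 20 reduces this further to `surj(3)`; at an additive `3` it does not reduce:
Elkies 2006.) [cite: Kato2004Asterisque, (12.5.2) in Thm. 12.5 (4) (p. 222), Thm. 17.4 (3) (p. 273); SerreAbelianLadic1968, Ch. IV §3.4 Lemma 3 (IV-23)] -/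
theorem imageContainsSL2_three_iff_hasSurjectiveModNGaloisRep_nine (W : WeierstrassCurve ℚ)
    [W.IsElliptic] [Fact (Nat.Prime 3)] :
    ImageContainsSL2 W 3 ↔ W.HasSurjectiveModNGaloisRep 9 := by
  rw [imageContainsSL2_iff_hasSurjectiveModNGaloisRep_sq W 3 (by norm_num),
    show ((3 ^ 2 : ℕ) : ℤ) = 9 by norm_num]

end Kato2004

end Literature.NumberTheory.EllipticCurves

namespace WeierstrassCurve

/-! ### Kato's remark after (12.8.1): stable lattices are homothetic when `E[p]` is irreducible (appended 2026-08-21, cell `b2b-bsdres`, lit-kato gen 4)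

Kato, Astérisque 295, p. 223, Remark 12.8, verbatim (page image read 2026-08-21, cell file
`b2b-bsdres-lit-kato/KATO-PAGE-READ-gen5.md` §1.5; an earlier version of this paragraph quoted an
OCR paraphrase): "By Ribet [Ri1, Ri3] (generalization of Serre [Se3]), we have the following. (12.8.1)
If `f` has no CM, then, for almost all finite places `λ` of `F`, there exist a `Gal(ℚ̄/ℚ)`-stable
`O_λ`-lattice `T` of `V_{F_λ}(f)` which satisfies the condition (12.5.2) at Thm 12.5 (4). Note that if
the condition (12.5.2) at Thm 12.5 (4) is satisfied for one `Gal(ℚ̄/ℚ)`-stable `O_λ`-lattice `T` of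
`V_{F_λ}(f)`, all `Gal(ℚ̄/ℚ)`-stable `O_λ`-lattices of `V_{F_λ}(f)` have the form `aT` for some
`a ∈ F_λ^×` (see the proof of 14.7), and hence the condition (12.5.2) at Thm 12.5 (4) is satisfied for
any `Gal(ℚ̄/ℚ)`-stable `O_λ`-lattice of `V_{F_λ}(f)`."  The numbered home of the statement is
**Lemma 14.7** (p. 238): "Almost all finite places `λ` of `F` satisfy the following condition: For
any finite extension `P` of `F_λ` and for any two `Gal(ℚ̄/ℚ)`-stable `O_P`-lattices `T, T′` of
`V_{F_λ}(f) ⊗_{F_λ} P`, there exists `a ∈ P^×` such that `T′ = aT`", whose printed proof applies the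
matrices `(1 1; 0 1)`, `(1 0; 1 1)`, `(0 −1; 1 0) ∈ SL₂(ℤ_p)` to a lattice vector.  The argument
below uses only the irreducibility of `T/𝔪_λT` (which (12.5.2) implies) and is the usual Nakayama
one, so the tree theorem is stated under that WEAKER hypothesis; the two theorems below PROVE it for `T = T_pE` over any
field `F` (`T_pE` finitely generated and free over `ℤ_p`, Silverman III.7.1 — tree theorems), in the
form "a `Γ_F`-stable `ℤ_p`-submodule `L ⊆ T_pE` containing `p^m T_pE` (resp. of finite index) is
`p^k T_pE`".  So every statement of Kato's §§12–17 transcribed in the tree "for `T = T_pE`"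
(`kato_divisibility` (3), the `Kato2004/BigImage…` readings, `…AdditivePotGood…`), printed "for a
`Gal(ℚ̄/ℚ)`-stable `O_λ`-lattice `T` of `V_{F_λ}(f)`", loses no generality at a prime where `E[p]` is
irreducible: every such lattice is `p^k T_pE` up to the scalar `a ∈ ℚ_p^×`, and Kato's hypotheses and
conclusions ((12.5.2), `X(T)`, `[H¹ : z]`, `#H²`) are invariant under `T ↦ aT`.  Theorems only. -/


open Literature.NumberTheory.EllipticCurves

variable {F : Type*} [Field F] (W : WeierstrassCurve F) [W.IsElliptic] (p : ℕ) [Fact p.Prime]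

/-- **Kato 2004, remark after (12.8.1) (p. 223), for `T = T_pE`: if `E[p]` is irreducible then every
`Γ_F`-stable `ℤ_p`-sublattice of `T_pE` is `p^k · T_pE`.**  Kato (p. 223): "if the condition
(12.5.2) at Thm 12.5 (4) is satisfied for one `Gal(ℚ̄/ℚ)`-stable `O_λ`-lattice `T` of `V_{F_λ}(f)`,
all `Gal(ℚ̄/ℚ)`-stable `O_λ`-lattices of `V_{F_λ}(f)` have the form `aT` for some `a ∈ F_λ^×` (see
the proof of 14.7)"; (12.5.2) implies that `T/𝔪T = E[p]` is irreducible, which is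
all the argument uses: for a stable `L` with `p^m T ⊆ L ⊆ T`, take `k ≤ m` largest with `L ⊆ p^k T`;
then `L = p^k L'` with `L'` stable and `L' ⊄ pT`, the image of `L'` in `T/pT = E[p]` is a non-zero
stable subgroup, hence everything, so `T = L' + pT` and `L' = T` by Nakayama.  Here `T = T_pE`
(`W.tateModule p`, finitely generated and free over `ℤ_p`: Silverman III.7.1, tree theorems
`module_finite_tateModule_holds`, `module_free_tateModule_holds`), `T → E[p]` is the first
projection (onto: `proj_surjective_of_isAlgClosed_holds`; kernel `pT`), stability is under the
componentwise action of `Γ_F` (`σ • x`, i.e. `ρ_{E,p}(σ) x`, `galoisRepTate_apply_apply`) and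
irreducibility is the tree's `HasIrreducibleModPGaloisRep` ("the only `Γ_F`-stable subgroups of
`E[p]` are `⊥` and `⊤`").  Consequently the choice of the lattice `T_pE` in the tree's transcriptions
of Kato's theorems (which are stated "for a `Gal(ℚ̄/ℚ)`-stable `O_λ`-lattice `T`") loses nothing when
`E[p]` is irreducible, in particular under (12.5.2).
[cite: Kato2004Asterisque, remark after (12.8.1) (p. 223); Lemma 14.7 (p. 238); (12.5.2) in Thm. 12.5 (4) (p. 222)] -/
theorem exists_eq_pow_smul_of_galoisStable_of_hasIrreducibleModPGaloisRep
    (hirr : W.HasIrreducibleModPGaloisRep p) (L : Submodule ℤ_[p] (W.tateModule p))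
    (hL : ∀ (σ : absoluteGaloisGroup F), ∀ x ∈ L, σ • x ∈ L)
    {m : ℕ} (hm : ∀ x : W.tateModule p, ((p : ℤ_[p]) ^ m) • x ∈ L) :
    ∃ k ≤ m, ∀ x : W.tateModule p, x ∈ L ↔ ∃ y : W.tateModule p, x = ((p : ℤ_[p]) ^ k) • y := by
  have hp : p.Prime := Fact.out
  set T := W.tateModule p
  haveI : Module.Finite ℤ_[p] T := module_finite_tateModule_holds W p
  haveI : Module.Free ℤ_[p] T := module_free_tateModule_holds W p
  set ϖ : ℤ_[p] := (p : ℤ_[p]) with hϖ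
  -- `P j`: `L ⊆ p^j T`
  let P : ℕ → Prop := fun j ↦ ∀ x ∈ L, ∃ y : T, x = (ϖ ^ j) • y
  have hP0 : P 0 := fun x _ ↦ ⟨x, by rw [pow_zero, one_smul]⟩
  set k := Nat.findGreatest P m with hk
  have hkm : k ≤ m := Nat.findGreatest_le m
  have hPk : P k := Nat.findGreatest_spec (P := P) (Nat.zero_le m) hP0
  refine ⟨k, hkm, ?_⟩
  -- `L' = (p^k)⁻¹ L`
  let L' : Submodule ℤ_[p] T := L.comap ((ϖ ^ k) • LinearMap.id)
  have hL'mem : ∀ y : T, y ∈ L' ↔ (ϖ ^ k) • y ∈ L := fun y ↦ by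
    simp [L', Submodule.mem_comap]
  have hL'st : ∀ (σ : absoluteGaloisGroup F), ∀ y ∈ L', σ • y ∈ L' := by
    intro σ y hy
    rw [hL'mem] at hy ⊢
    rw [← smul_comm σ (ϖ ^ k) y]
    exact hL σ _ hy
  -- it suffices that `L' = ⊤`
  suffices hL'top : L' = ⊤ by
    intro x
    refine ⟨hPk x, ?_⟩
    rintro ⟨y, rfl⟩
    have hy : y ∈ L' := by rw [hL'top]; exact Submodule.mem_top
    exact (hL'mem y).mp hy
  -- case `k = m`: `p^m T ⊆ L` gives `L' = ⊤` directly
  rcases hkm.eq_or_lt with hkeq | hklt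
  · refine Submodule.eq_top_iff'.mpr fun y ↦ ?_
    rw [hL'mem, hkeq]
    exact hm y
  -- case `k < m`: `¬ P (k+1)`, so some `y₀ ∈ L'` is not in `pT`
  have hnot : ¬ P (k + 1) :=
    Nat.findGreatest_is_greatest (Nat.lt_succ_self k) (Nat.succ_le_of_lt hklt)
  obtain ⟨y₀, hy₀L', hy₀⟩ : ∃ y₀ ∈ L', ∀ z : T, y₀ ≠ ϖ • z := by
    by_contra hcon
    push Not at hcon
    apply hnot
    intro x hx
    obtain ⟨y, rfl⟩ := hPk x hx
    have hy : y ∈ L' := (hL'mem y).mpr hx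
    obtain ⟨z, hz⟩ := hcon y hy
    exact ⟨z, by rw [hz, smul_smul, ← pow_succ]⟩
  -- the image `H` of `L'` in `E[p]`
  have hmem1 : ∀ a : T, TateModule.proj p 1 a ∈ geomTorsion W (p : ℕ) := fun a ↦ by
    simpa only [pow_one] using proj_tateModule_mem_geomTorsion W p 1 a
  let H : AddSubgroup (geomTorsion W (p : ℕ)) :=
    { carrier := {Q | ∃ y ∈ L', TateModule.proj p 1 y = (Q : geomPoints W)}
      zero_mem' := ⟨0, L'.zero_mem, by simp⟩
      add_mem' := by
        rintro Q Q' ⟨y, hy, hyQ⟩ ⟨y', hy', hyQ'⟩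
        exact ⟨y + y', L'.add_mem hy hy', by simp [hyQ, hyQ']⟩
      neg_mem' := by
        rintro Q ⟨y, hy, hyQ⟩
        exact ⟨-y, L'.neg_mem hy, by simp [hyQ]⟩ }
  have hHst : ∀ σ : absoluteGaloisGroup F, ∀ Q ∈ H, σ • Q ∈ H := by
    rintro σ Q ⟨y, hy, hyQ⟩
    refine ⟨σ • y, hL'st σ y hy, ?_⟩
    rw [TateModule.proj_smul_of_distribMulAction, hyQ]
    rfl
  have hHtop : H = ⊤ := by
    rcases hirr H hHst with hbot | htop
    · exfalso
      have hQ0 : (⟨TateModule.proj p 1 y₀, hmem1 y₀⟩ : geomTorsion W (p : ℕ)) ∈ H :=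
        ⟨y₀, hy₀L', rfl⟩
      rw [hbot, AddSubgroup.mem_bot] at hQ0
      have h0 : TateModule.proj p 1 y₀ = 0 := congrArg Subtype.val hQ0
      obtain ⟨z, hz⟩ := TateModule.proj_ker_eq_pow_smul_aux' 1 y₀ h0
      exact hy₀ z (by rw [hz, pow_one])
    · exact htop
  -- `T = L' + pT`
  have hsup : (⊤ : Submodule ℤ_[p] T) ≤ L' ⊔ (Ideal.span {ϖ}) • ⊤ := by
    intro t _
    have ht : (⟨TateModule.proj p 1 t, hmem1 t⟩ : geomTorsion W (p : ℕ)) ∈ H := by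
      rw [hHtop]; exact AddSubgroup.mem_top _
    obtain ⟨y, hy, hyt⟩ := ht
    have h0 : TateModule.proj p 1 (t - y) = 0 := by
      rw [map_sub, sub_eq_zero]; exact hyt.symm
    obtain ⟨z, hz⟩ := TateModule.proj_ker_eq_pow_smul_aux' 1 (t - y) h0
    rw [pow_one] at hz
    have : t = y + ϖ • z := by rw [← hz]; abel
    rw [this]
    exact Submodule.add_mem_sup hy
      (Submodule.smul_mem_smul (Ideal.mem_span_singleton_self ϖ) Submodule.mem_top)
  -- Nakayama
  have hjac : Ideal.span {ϖ} ≤ (⊥ : Ideal ℤ_[p]).jacobson := by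
    rw [IsLocalRing.jacobson_eq_maximalIdeal ⊥ bot_ne_top, PadicInt.maximalIdeal_eq_span_p]
  have htop : (⊤ : Submodule ℤ_[p] T) ≤ L' :=
    Submodule.le_of_le_smul_of_le_jacobson_bot Module.Finite.fg_top hjac hsup
  exact eq_top_iff.mpr htop

/-- **The same for any stable sublattice of finite index** (a "lattice" `L ⊆ T_pE` in Kato's sense,
i.e. commensurable with `T_pE`): if `E[p]` is irreducible and `L ⊆ T_pE` is a `Γ_F`-stable
`ℤ_p`-submodule of finite index, then `L = p^k · T_pE` for some `k`.  (Finite index `n = p^a u`,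
`p ∤ u`, gives `p^a T_pE ⊆ L` because `u` is a unit of `ℤ_p`; then apply
`exists_eq_pow_smul_of_galoisStable_of_hasIrreducibleModPGaloisRep`.)  Kato, Astérisque 295, remark
after (12.8.1), p. 223 ("all `Gal(ℚ̄/ℚ)`-stable `O_λ`-lattices of `V_{F_λ}(f)` have the form `aT`") and
Lemma 14.7, p. 238.
[cite: Kato2004Asterisque, remark after (12.8.1) (p. 223); Lemma 14.7 (p. 238)] -/
theorem exists_eq_pow_smul_of_galoisStable_of_finiteIndex
    (hirr : W.HasIrreducibleModPGaloisRep p) (L : Submodule ℤ_[p] (W.tateModule p))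
    (hL : ∀ (σ : absoluteGaloisGroup F), ∀ x ∈ L, σ • x ∈ L)
    [hfi : L.toAddSubgroup.FiniteIndex] :
    ∃ k : ℕ, ∀ x : W.tateModule p, x ∈ L ↔ ∃ y : W.tateModule p, x = ((p : ℤ_[p]) ^ k) • y := by
  have hp : p.Prime := Fact.out
  set n := L.toAddSubgroup.index with hn
  have hn0 : n ≠ 0 := hfi.index_ne_zero
  obtain ⟨a, u, hu, hnau⟩ := Nat.exists_eq_pow_mul_and_not_dvd hn0 p hp.ne_one
  -- `u` is a unit of `ℤ_p`
  have huU : IsUnit (u : ℤ_[p]) := by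
    rw [PadicInt.isUnit_iff]
    have h1 : ‖((u : ℤ) : ℤ_[p])‖ = 1 := by
      refine le_antisymm (PadicInt.norm_le_one _) (not_lt.mp fun hlt ↦ hu ?_)
      exact_mod_cast (PadicInt.norm_int_lt_one_iff_dvd (u : ℤ)).mp hlt
    simpa using h1
  obtain ⟨v, hv⟩ := huU
  have hm : ∀ x : W.tateModule p, ((p : ℤ_[p]) ^ a) • x ∈ L := by
    intro x
    have hnx : (n : ℤ_[p]) • x ∈ L := by
      rw [Nat.cast_smul_eq_nsmul]
      exact L.toAddSubgroup.nsmul_index_mem x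
    have hcalc : ((p : ℤ_[p]) ^ a) • x = (↑v⁻¹ : ℤ_[p]) • ((n : ℤ_[p]) • x) := by
      rw [hnau, smul_smul, Nat.cast_mul, Nat.cast_pow, ← hv, ← mul_assoc, mul_comm (↑v⁻¹ : ℤ_[p]),
        mul_assoc ((p : ℤ_[p]) ^ a), Units.inv_mul, mul_one]
    rw [hcalc]
    exact L.smul_mem _ hnx
  obtain ⟨k, -, hk⟩ :=
    exists_eq_pow_smul_of_galoisStable_of_hasIrreducibleModPGaloisRep W p hirr L hL hm
  exact ⟨k, hk⟩

end WeierstrassCurve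


namespace WeierstrassCurve

/-! ### The level-`p²` certificate: ONE first-order kernel witness gives the tower (appended 2026-08-21, cell `b2b-bsdres`, lit-kato gen 6)

For an odd prime `p`, the image `G` of `ρ̄_{E,p²}` lies over `ρ̄_{E,p}(Γ_ℚ)`; when the latter is
`GL₂(𝔽_p)`, `G ∩ ker(GL₂(ℤ/p²) → GL₂(𝔽_p))` is a subgroup of `1 + p M₂(𝔽_p) ≅ (M₂(𝔽_p), +)` stable
under conjugation by `GL₂(𝔽_p)`, and the only such subgroups are `0`, `𝔽_p · 1`, `sl₂(𝔽_p)` and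
`M₂(𝔽_p)` (`M₂ = 𝔽_p ⊕ sl₂` for `p` odd, and the conjugates of any non-zero traceless matrix span
`sl₂` — the additive generation used in Serre's proof of the lifting lemma, *Abelian `ℓ`-adic
representations* IV-23, via Lang, *Elliptic Functions* Ch. 17 §4).  Hence ONE element of `G` of the
form `1 + p M₀` with `M₀` neither scalar nor traceless modulo `p` forces `G = GL₂(ℤ/p²)`, and then
`ρ̄_{E,p^n}` onto for all `n` (`forall_hasSurjectiveModNGaloisRep_of_hasSurjectiveModNGaloisRep_sq`).
Everything is phrased on `T_pE` in a `ℤ_p`-basis `b`, exactly as in the previous sections: a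
"first-order kernel element" is a matrix `M` with `ρ(τ) = 1 + p M + p² V` in the basis `b` for some
`τ ∈ Γ_ℚ` and some `V`; these are closed under `+`, `ℤ_p`-multiples, `M ↦ M + pY`, and (given
surj(p)) conjugation by `GL₂(ℤ_p)`; the generation is done with the explicit matrices
`(1 ±1; 0 1)`, `(1 0; 1 1)`, `(0 1; -1 0)`.  Main statements:
`forall_hasSurjectiveModNGaloisRep_of_hasSurjectiveModNGaloisRep_of_firstOrder` (surj(p) + all
first-order elements ⟹ the tower), `forall_hasSurjectiveModNGaloisRep_of_firstOrderWitness`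
(surj(p) + ONE witness ⟹ the tower) and `Kato2004.imageContainsSL2_of_firstOrderWitness`
((12.5.2)).  At `p = 3`, where surj(3) does NOT lift by itself (Serre's remark that
`SL₂(ℤ/9) → SL₂(𝔽₃)` has a section; Elkies, arXiv:math/0612734, Introduction and §1: the
`27` conjugate lifts and the genus-`0` curve `X(9)/G` of degree `27` over `X(1)`), the witness is
supplied by ONE Frobenius element — see `Kato2004/ThreeAdicFrobeniusCertificate.lean` (cell
`b2b-bsdres`: the rows of class X4 at `p = 3` with no (ram)/`j`-witness prime).  Theorems only; no
definition, no named fact. -/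

open Literature.NumberTheory.EllipticCurves Literature.NumberTheory.GaloisRepresentations

variable (W : WeierstrassCurve ℚ) (p : ℕ) [Fact p.Prime]

/-! #### Pure `2 × 2` matrix identities over a commutative ring -/

section MatrixIdentities

variable {R : Type*} [CommRing R]

/-- Product of two first-order expansions `(1 + aM₁ + a²V₁)(1 + aM₂ + a²V₂)`, `2 × 2` matrices over a commutative ring. [folklore] -/
private theorem mat_one_add_mul_one_add (a : R) (M₁ M₂ V₁ V₂ : Matrix (Fin 2) (Fin 2) R) :
    (1 + a • M₁ + a ^ 2 • V₁) * (1 + a • M₂ + a ^ 2 • V₂) =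
      1 + a • (M₁ + M₂) +
        a ^ 2 • (V₁ + V₂ + M₁ * M₂ + a • (M₁ * V₂ + V₁ * M₂) + a ^ 2 • (V₁ * V₂)) := by
  ext i j
  fin_cases i <;> fin_cases j <;>
    simp [Matrix.mul_apply, Fin.sum_univ_two, Matrix.add_apply, Matrix.smul_apply,
      Matrix.one_apply] <;> ring

/-- `(B + aC) M (B' - aE) = B M B' + a(…)`, `2 × 2` matrices over a commutative ring. [folklore] -/
private theorem mat_conj_expand (a : R) (B C M B' E : Matrix (Fin 2) (Fin 2) R) :
    (B + a • C) * M * (B' - a • E) =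
      B * M * B' + a • (C * M * B' - B * M * E - a • (C * M * E)) := by
  ext i j
  fin_cases i <;> fin_cases j <;>
    simp [Matrix.mul_apply, Fin.sum_univ_two, Matrix.add_apply, Matrix.sub_apply,
      Matrix.smul_apply] <;> ring

/-- `X (1 + aM + a²V) U = XU + a XMU + a² XVU`. [folklore] -/
private theorem mat_mul_one_add_mul (a : R) (X M V U : Matrix (Fin 2) (Fin 2) R) :
    X * (1 + a • M + a ^ 2 • V) * U = X * U + a • (X * M * U) + a ^ 2 • (X * V * U) := by
  ext i j
  fin_cases i <;> fin_cases j <;>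
    simp [Matrix.mul_apply, Fin.sum_univ_two, Matrix.add_apply, Matrix.smul_apply,
      Matrix.one_apply] <;> ring

end MatrixIdentities

/-! #### First-order kernel elements, read on matrices in a basis of `T_pE` -/

section FirstOrder

variable (b : Module.Basis (Fin 2) ℤ_[p] (W.tateModule p))

/-- Matrices of `ρ` are multiplicative. [folklore] -/
private theorem toMatrix_galoisRepTate_mul (σ τ : absoluteGaloisGroup ℚ) :
    LinearMap.toMatrix b b (W.galoisRepTate p (σ * τ)) =
      LinearMap.toMatrix b b (W.galoisRepTate p σ) * LinearMap.toMatrix b b (W.galoisRepTate p τ) := by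
  rw [map_mul, LinearMap.toMatrix_mul]

/-- `[ρ(σ)] [ρ(σ⁻¹)] = 1` in a basis. [folklore] -/
private theorem toMatrix_galoisRepTate_mul_inv (σ : absoluteGaloisGroup ℚ) :
    LinearMap.toMatrix b b (W.galoisRepTate p σ) * LinearMap.toMatrix b b (W.galoisRepTate p σ⁻¹) = 1 := by
  rw [← LinearMap.toMatrix_mul, ← map_mul, mul_inv_cancel, map_one, LinearMap.toMatrix_one]

/-- `[ρ(σ⁻¹)] [ρ(σ)] = 1` in a basis. [folklore] -/
private theorem toMatrix_galoisRepTate_inv_mul (σ : absoluteGaloisGroup ℚ) :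
    LinearMap.toMatrix b b (W.galoisRepTate p σ⁻¹) * LinearMap.toMatrix b b (W.galoisRepTate p σ) = 1 := by
  rw [← LinearMap.toMatrix_mul, ← map_mul, inv_mul_cancel, map_one, LinearMap.toMatrix_one]

/-- `0` is a first-order kernel element (`τ = 1`). [folklore] -/
private theorem firstOrder_zero :
    ∃ (τ : absoluteGaloisGroup ℚ) (V : Matrix (Fin 2) (Fin 2) ℤ_[p]),
      LinearMap.toMatrix b b (W.galoisRepTate p τ) =
        1 + (p : ℤ_[p]) • (0 : Matrix (Fin 2) (Fin 2) ℤ_[p]) + ((p : ℤ_[p]) ^ 2) • V :=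
  ⟨1, 0, by rw [map_one, LinearMap.toMatrix_one, smul_zero, smul_zero, add_zero, add_zero]⟩

variable {W p b}

/-- First-order kernel elements are closed under addition (`τ₁ τ₂`). [folklore] -/
private theorem firstOrder_add {M₁ M₂ : Matrix (Fin 2) (Fin 2) ℤ_[p]}
    (h₁ : ∃ (τ : absoluteGaloisGroup ℚ) (V : Matrix (Fin 2) (Fin 2) ℤ_[p]),
      LinearMap.toMatrix b b (W.galoisRepTate p τ) = 1 + (p : ℤ_[p]) • M₁ + ((p : ℤ_[p]) ^ 2) • V)
    (h₂ : ∃ (τ : absoluteGaloisGroup ℚ) (V : Matrix (Fin 2) (Fin 2) ℤ_[p]),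
      LinearMap.toMatrix b b (W.galoisRepTate p τ) = 1 + (p : ℤ_[p]) • M₂ + ((p : ℤ_[p]) ^ 2) • V) :
    ∃ (τ : absoluteGaloisGroup ℚ) (V : Matrix (Fin 2) (Fin 2) ℤ_[p]),
      LinearMap.toMatrix b b (W.galoisRepTate p τ) =
        1 + (p : ℤ_[p]) • (M₁ + M₂) + ((p : ℤ_[p]) ^ 2) • V := by
  obtain ⟨τ₁, V₁, h₁⟩ := h₁
  obtain ⟨τ₂, V₂, h₂⟩ := h₂
  refine ⟨τ₁ * τ₂, V₁ + V₂ + M₁ * M₂ + (p : ℤ_[p]) • (M₁ * V₂ + V₁ * M₂) +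
    ((p : ℤ_[p]) ^ 2) • (V₁ * V₂), ?_⟩
  rw [toMatrix_galoisRepTate_mul, h₁, h₂, mat_one_add_mul_one_add]

/-- `M` is first order iff `M + pY` is. [folklore] -/
private theorem firstOrder_add_p_smul {M : Matrix (Fin 2) (Fin 2) ℤ_[p]} (Y : Matrix (Fin 2) (Fin 2) ℤ_[p])
    (h : ∃ (τ : absoluteGaloisGroup ℚ) (V : Matrix (Fin 2) (Fin 2) ℤ_[p]),
      LinearMap.toMatrix b b (W.galoisRepTate p τ) = 1 + (p : ℤ_[p]) • M + ((p : ℤ_[p]) ^ 2) • V) :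
    ∃ (τ : absoluteGaloisGroup ℚ) (V : Matrix (Fin 2) (Fin 2) ℤ_[p]),
      LinearMap.toMatrix b b (W.galoisRepTate p τ) =
        1 + (p : ℤ_[p]) • (M + (p : ℤ_[p]) • Y) + ((p : ℤ_[p]) ^ 2) • V := by
  obtain ⟨τ, V, h⟩ := h
  refine ⟨τ, V - Y, ?_⟩
  rw [h, smul_add, smul_sub, smul_smul, ← pow_two]
  abel

/-- Natural multiples. [folklore] -/
private theorem firstOrder_nsmul {M : Matrix (Fin 2) (Fin 2) ℤ_[p]}
    (h : ∃ (τ : absoluteGaloisGroup ℚ) (V : Matrix (Fin 2) (Fin 2) ℤ_[p]),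
      LinearMap.toMatrix b b (W.galoisRepTate p τ) = 1 + (p : ℤ_[p]) • M + ((p : ℤ_[p]) ^ 2) • V)
    (k : ℕ) :
    ∃ (τ : absoluteGaloisGroup ℚ) (V : Matrix (Fin 2) (Fin 2) ℤ_[p]),
      LinearMap.toMatrix b b (W.galoisRepTate p τ) =
        1 + (p : ℤ_[p]) • (k • M) + ((p : ℤ_[p]) ^ 2) • V := by
  induction k with
  | zero => rw [zero_smul]; exact firstOrder_zero W p b
  | succ k ih => rw [succ_nsmul]; exact firstOrder_add ih h

/-- `ℤ_p`-multiples: `c = k + p c'` with `k ∈ ℕ`. [folklore] -/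
private theorem firstOrder_smul {M : Matrix (Fin 2) (Fin 2) ℤ_[p]}
    (h : ∃ (τ : absoluteGaloisGroup ℚ) (V : Matrix (Fin 2) (Fin 2) ℤ_[p]),
      LinearMap.toMatrix b b (W.galoisRepTate p τ) = 1 + (p : ℤ_[p]) • M + ((p : ℤ_[p]) ^ 2) • V)
    (c : ℤ_[p]) :
    ∃ (τ : absoluteGaloisGroup ℚ) (V : Matrix (Fin 2) (Fin 2) ℤ_[p]),
      LinearMap.toMatrix b b (W.galoisRepTate p τ) =
        1 + (p : ℤ_[p]) • (c • M) + ((p : ℤ_[p]) ^ 2) • V := by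
  have hc : c - (c.zmodRepr : ℤ_[p]) ∈ Ideal.span {(p : ℤ_[p])} := by
    rw [← PadicInt.maximalIdeal_eq_span_p]; exact PadicInt.sub_zmodRepr_mem c
  obtain ⟨c', hc'⟩ := Ideal.mem_span_singleton.mp hc
  have hcM : c • M = c.zmodRepr • M + (p : ℤ_[p]) • (c' • M) := by
    rw [← Nat.cast_smul_eq_nsmul ℤ_[p], smul_smul, ← add_smul, ← hc', add_sub_cancel]
  rw [hcM]
  exact firstOrder_add_p_smul _ (firstOrder_nsmul h _)

/-- First-order kernel elements are closed under negation. [folklore] -/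
private theorem firstOrder_neg {M : Matrix (Fin 2) (Fin 2) ℤ_[p]}
    (h : ∃ (τ : absoluteGaloisGroup ℚ) (V : Matrix (Fin 2) (Fin 2) ℤ_[p]),
      LinearMap.toMatrix b b (W.galoisRepTate p τ) = 1 + (p : ℤ_[p]) • M + ((p : ℤ_[p]) ^ 2) • V) :
    ∃ (τ : absoluteGaloisGroup ℚ) (V : Matrix (Fin 2) (Fin 2) ℤ_[p]),
      LinearMap.toMatrix b b (W.galoisRepTate p τ) =
        1 + (p : ℤ_[p]) • (-M) + ((p : ℤ_[p]) ^ 2) • V := by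
  have := firstOrder_smul h (-1)
  rwa [neg_one_smul] at this

/-- First-order kernel elements are closed under subtraction. [folklore] -/
private theorem firstOrder_sub {M₁ M₂ : Matrix (Fin 2) (Fin 2) ℤ_[p]}
    (h₁ : ∃ (τ : absoluteGaloisGroup ℚ) (V : Matrix (Fin 2) (Fin 2) ℤ_[p]),
      LinearMap.toMatrix b b (W.galoisRepTate p τ) = 1 + (p : ℤ_[p]) • M₁ + ((p : ℤ_[p]) ^ 2) • V)
    (h₂ : ∃ (τ : absoluteGaloisGroup ℚ) (V : Matrix (Fin 2) (Fin 2) ℤ_[p]),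
      LinearMap.toMatrix b b (W.galoisRepTate p τ) = 1 + (p : ℤ_[p]) • M₂ + ((p : ℤ_[p]) ^ 2) • V) :
    ∃ (τ : absoluteGaloisGroup ℚ) (V : Matrix (Fin 2) (Fin 2) ℤ_[p]),
      LinearMap.toMatrix b b (W.galoisRepTate p τ) =
        1 + (p : ℤ_[p]) • (M₁ - M₂) + ((p : ℤ_[p]) ^ 2) • V := by
  rw [sub_eq_add_neg]; exact firstOrder_add h₁ (firstOrder_neg h₂)

/-- **Conjugation.**  If `ρ̄_{E,p}` is onto, the first-order kernel elements are stable under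
`M ↦ B M B⁻¹` for every invertible `B ∈ M₂(ℤ_p)`: realise `B ≡ ρ(σ) (mod p)` and conjugate `τ`
by `σ` (the step "`X` is stable under conjugation" of Serre's proof).
[cite: SerreAbelianLadic1968, Ch. IV §3.4, Lemma 3 (IV-23), proof] -/
theorem firstOrder_conj [W.IsElliptic] (h1 : W.HasSurjectiveModNGaloisRep p) {M : Matrix (Fin 2) (Fin 2) ℤ_[p]}
    (h : ∃ (τ : absoluteGaloisGroup ℚ) (V : Matrix (Fin 2) (Fin 2) ℤ_[p]),
      LinearMap.toMatrix b b (W.galoisRepTate p τ) = 1 + (p : ℤ_[p]) • M + ((p : ℤ_[p]) ^ 2) • V)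
    (B B' : Matrix (Fin 2) (Fin 2) ℤ_[p]) (hBB' : B * B' = 1) :
    ∃ (τ : absoluteGaloisGroup ℚ) (V : Matrix (Fin 2) (Fin 2) ℤ_[p]),
      LinearMap.toMatrix b b (W.galoisRepTate p τ) =
        1 + (p : ℤ_[p]) • (B * M * B') + ((p : ℤ_[p]) ^ 2) • V := by
  obtain ⟨τ, V, hτ⟩ := h
  -- `B ≡ ρ(σ) (mod p)`
  have hBdet : IsUnit B.det := by
    have h := congrArg Matrix.det hBB'
    rw [Matrix.det_mul, Matrix.det_one] at h
    exact IsUnit.of_mul_eq_one _ h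
  have hAdet : IsUnit (LinearMap.det (Matrix.toLin b b B)) := by
    rwa [LinearMap.det_toLin]
  have h1' : W.HasSurjectiveModNGaloisRep (p ^ 1 : ℕ) := by rwa [pow_one]
  obtain ⟨σ, C, hσ⟩ :=
    exists_galoisRepTate_eq_add_smul_of_hasSurjectiveModNGaloisRep W p h1' (Matrix.toLin b b B) hAdet
  set Rσ := LinearMap.toMatrix b b (W.galoisRepTate p σ) with hRσ
  set Cm := LinearMap.toMatrix b b C with hCm
  have hσm : Rσ = B + (p : ℤ_[p]) • Cm := by
    rw [hRσ, hσ, map_add, map_smul, LinearMap.toMatrix_toLin, pow_one]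
  set U := LinearMap.toMatrix b b (W.galoisRepTate p σ⁻¹) with hUdef
  have hU1 : U * Rσ = 1 := toMatrix_galoisRepTate_inv_mul W p b σ
  have hU2 : Rσ * U = 1 := toMatrix_galoisRepTate_mul_inv W p b σ
  set E := U * Cm * B' with hE
  have hU : U = B' - (p : ℤ_[p]) • E := by
    have hB : B = Rσ - (p : ℤ_[p]) • Cm := by rw [hσm, add_sub_cancel_right]
    calc U = U * (B * B') := by rw [hBB', mul_one]
      _ = U * (Rσ - (p : ℤ_[p]) • Cm) * B' := by rw [← mul_assoc, hB]
      _ = B' - (p : ℤ_[p]) • E := by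
        rw [mul_sub, hU1, Matrix.mul_smul, sub_mul, one_mul, Matrix.smul_mul, hE]
  refine ⟨σ * τ * σ⁻¹,
    (Cm * M * B' - B * M * E - (p : ℤ_[p]) • (Cm * M * E)) + Rσ * V * U, ?_⟩
  rw [toMatrix_galoisRepTate_mul, toMatrix_galoisRepTate_mul, ← hRσ, ← hUdef, hτ,
    mat_mul_one_add_mul, hU2]
  conv_lhs => rw [hσm, hU, mat_conj_expand, ← hU, ← hσm]
  rw [smul_add, smul_add, smul_smul, ← pow_two]
  abel

/-! #### Generation: one witness with a unit off-diagonal entry and unit trace gives everything -/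

section MatrixIdentities2

variable {R : Type*} [CommRing R]

/-- Conjugation by `(1 1; 0 1)` minus the identity, on a `2 × 2` matrix. [folklore] -/
private theorem mat_upper_conj (M : Matrix (Fin 2) (Fin 2) R) :
    !![(1 : R), 1; 0, 1] * M * !![(1 : R), -1; 0, 1] - M =
      !![M 1 0, M 1 1 - M 0 0 - M 1 0; 0, -M 1 0] := by
  ext i j
  fin_cases i <;> fin_cases j <;>
    simp only [Matrix.sub_apply, Matrix.mul_apply, Fin.sum_univ_two,
      Matrix.of_apply, Matrix.cons_val', Matrix.cons_val_zero, Matrix.cons_val_one,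
      Matrix.empty_val', Matrix.cons_val_fin_one, Fin.zero_eta, Fin.mk_one, Fin.isValue] <;> ring

/-- Conjugation by `(1 -1; 0 1)` minus the identity, on a `2 × 2` matrix. [folklore] -/
private theorem mat_upper_conj' (M : Matrix (Fin 2) (Fin 2) R) :
    !![(1 : R), -1; 0, 1] * M * !![(1 : R), 1; 0, 1] - M =
      !![-M 1 0, M 0 0 - M 1 1 - M 1 0; 0, M 1 0] := by
  ext i j
  fin_cases i <;> fin_cases j <;>
    simp only [Matrix.sub_apply, Matrix.mul_apply, Fin.sum_univ_two,
      Matrix.of_apply, Matrix.cons_val', Matrix.cons_val_zero, Matrix.cons_val_one,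
      Matrix.empty_val', Matrix.cons_val_fin_one, Fin.zero_eta, Fin.mk_one, Fin.isValue] <;> ring

/-- The two differences add up to `-2 m₁₀ · (0 1; 0 0)`. [folklore] -/
private theorem mat_upper_conj_add (M : Matrix (Fin 2) (Fin 2) R) :
    !![M 1 0, M 1 1 - M 0 0 - M 1 0; 0, -M 1 0] + !![-M 1 0, M 0 0 - M 1 1 - M 1 0; 0, M 1 0] =
      (-(2 * M 1 0)) • !![(0 : R), 1; 0, 0] := by
  ext i j
  fin_cases i <;> fin_cases j <;>
    simp only [Matrix.add_apply, Matrix.smul_apply,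
      Matrix.of_apply, Matrix.cons_val', Matrix.cons_val_zero, Matrix.cons_val_one,
      Matrix.empty_val', Matrix.cons_val_fin_one, Fin.zero_eta, Fin.mk_one, Fin.isValue, smul_eq_mul] <;> ring

/-- `(1 1; 0 1)(1 -1; 0 1) = 1`. [folklore] -/
private theorem mat_upper_mul_upper' : !![(1 : R), 1; 0, 1] * !![(1 : R), -1; 0, 1] = 1 := by
  simp [Matrix.one_fin_two]

/-- `(1 -1; 0 1)(1 1; 0 1) = 1`. [folklore] -/
private theorem mat_upper'_mul_upper : !![(1 : R), -1; 0, 1] * !![(1 : R), 1; 0, 1] = 1 := by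
  simp [Matrix.one_fin_two]

/-- `(0 1; -1 0)(0 -1; 1 0) = 1`. [folklore] -/
private theorem mat_weyl_mul_weyl' : !![(0 : R), 1; -1, 0] * !![(0 : R), -1; 1, 0] = 1 := by
  simp [Matrix.one_fin_two]

/-- The Weyl element conjugates `(0 1; 0 0)` to `-(0 0; 1 0)`. [folklore] -/
private theorem mat_weyl_conj_e :
    !![(0 : R), 1; -1, 0] * !![(0 : R), 1; 0, 0] * !![(0 : R), -1; 1, 0] = -!![(0 : R), 0; 1, 0] := by
  ext i j
  fin_cases i <;> fin_cases j <;>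
    simp only [Matrix.neg_apply, Matrix.mul_apply, Fin.sum_univ_two,
      Matrix.of_apply, Matrix.cons_val', Matrix.cons_val_zero, Matrix.cons_val_one,
      Matrix.empty_val', Matrix.cons_val_fin_one, Fin.zero_eta, Fin.mk_one, Fin.isValue] <;> ring

/-- `(1 1; 0 1)(0 0; 1 0)(1 -1; 0 1) - (0 0; 1 0) + (0 1; 0 0) = diag(1, -1)`. [folklore] -/
private theorem mat_upper_conj_f :
    !![(1 : R), 1; 0, 1] * !![(0 : R), 0; 1, 0] * !![(1 : R), -1; 0, 1] - !![(0 : R), 0; 1, 0] +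
        !![(0 : R), 1; 0, 0] = !![(1 : R), 0; 0, -1] := by
  ext i j
  fin_cases i <;> fin_cases j <;>
    simp only [Matrix.sub_apply, Matrix.add_apply, Matrix.mul_apply, Fin.sum_univ_two,
      Matrix.of_apply, Matrix.cons_val', Matrix.cons_val_zero, Matrix.cons_val_one,
      Matrix.empty_val', Matrix.cons_val_fin_one, Fin.zero_eta, Fin.mk_one, Fin.isValue] <;> ring

/-- Conjugation of a `2 × 2` matrix by the Weyl element `(0 1; -1 0)`. [folklore] -/
private theorem mat_weyl_conj (M : Matrix (Fin 2) (Fin 2) R) :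
    !![(0 : R), 1; -1, 0] * M * !![(0 : R), -1; 1, 0] = !![M 1 1, -M 1 0; -M 0 1, M 0 0] := by
  ext i j
  fin_cases i <;> fin_cases j <;>
    simp only [Matrix.mul_apply, Fin.sum_univ_two,
      Matrix.of_apply, Matrix.cons_val', Matrix.cons_val_zero, Matrix.cons_val_one,
      Matrix.empty_val', Matrix.cons_val_fin_one, Fin.zero_eta, Fin.mk_one, Fin.isValue] <;> ring

/-- `(1 0; 1 1)(1 0; -1 1) = 1`. [folklore] -/
private theorem mat_lower_mul_lower' : !![(1 : R), 0; 1, 1] * !![(1 : R), 0; -1, 1] = 1 := by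
  simp [Matrix.one_fin_two]

/-- Conjugation of a `2 × 2` matrix by the lower unipotent `(1 0; 1 1)`. [folklore] -/
private theorem mat_lower_conj (M : Matrix (Fin 2) (Fin 2) R) :
    !![(1 : R), 0; 1, 1] * M * !![(1 : R), 0; -1, 1] =
      !![M 0 0 - M 0 1, M 0 1; M 0 0 + M 1 0 - M 0 1 - M 1 1, M 0 1 + M 1 1] := by
  ext i j
  fin_cases i <;> fin_cases j <;>
    simp only [Matrix.mul_apply, Fin.sum_univ_two,
      Matrix.of_apply, Matrix.cons_val', Matrix.cons_val_zero, Matrix.cons_val_one,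
      Matrix.empty_val', Matrix.cons_val_fin_one, Fin.zero_eta, Fin.mk_one, Fin.isValue] <;> ring

/-- `2M - 2m₀₁ e - 2m₁₀ f - (m₀₀ - m₁₁) h = tr(M) · 1` (`e, f, h` the standard `sl₂` triple). [folklore] -/
private theorem mat_scalar_part (M : Matrix (Fin 2) (Fin 2) R) :
    (2 : R) • M - (2 * M 0 1) • !![(0 : R), 1; 0, 0] - (2 * M 1 0) • !![(0 : R), 0; 1, 0] -
        (M 0 0 - M 1 1) • !![(1 : R), 0; 0, -1] = (M 0 0 + M 1 1) • (1 : Matrix (Fin 2) (Fin 2) R) := by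
  ext i j
  fin_cases i <;> fin_cases j <;>
    simp only [Matrix.sub_apply, Matrix.smul_apply, Matrix.one_fin_two,
      Matrix.of_apply, Matrix.cons_val', Matrix.cons_val_zero, Matrix.cons_val_one,
      Matrix.empty_val', Matrix.cons_val_fin_one, Fin.zero_eta, Fin.mk_one, Fin.isValue, smul_eq_mul] <;> ring

/-- `1 + diag(1,-1) = 2 E₁₁`. [folklore] -/
private theorem mat_one_add_h : (1 : Matrix (Fin 2) (Fin 2) R) + !![(1 : R), 0; 0, -1] =
    (2 : R) • !![(1 : R), 0; 0, 0] := by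
  ext i j
  fin_cases i <;> fin_cases j <;>
    simp only [Matrix.add_apply, Matrix.smul_apply, Matrix.one_fin_two,
      Matrix.of_apply, Matrix.cons_val', Matrix.cons_val_zero, Matrix.cons_val_one,
      Matrix.empty_val', Matrix.cons_val_fin_one, Fin.zero_eta, Fin.mk_one, Fin.isValue, smul_eq_mul] <;> ring

/-- `1 - diag(1,-1) = 2 E₂₂`. [folklore] -/
private theorem mat_one_sub_h : (1 : Matrix (Fin 2) (Fin 2) R) - !![(1 : R), 0; 0, -1] =
    (2 : R) • !![(0 : R), 0; 0, 1] := by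
  ext i j
  fin_cases i <;> fin_cases j <;>
    simp only [Matrix.sub_apply, Matrix.smul_apply, Matrix.one_fin_two,
      Matrix.of_apply, Matrix.cons_val', Matrix.cons_val_zero, Matrix.cons_val_one,
      Matrix.empty_val', Matrix.cons_val_fin_one, Fin.zero_eta, Fin.mk_one, Fin.isValue, smul_eq_mul] <;> ring

/-- A `2 × 2` matrix in the basis `E₁₁, e, f, E₂₂`. [folklore] -/
private theorem mat_eta (M : Matrix (Fin 2) (Fin 2) R) :
    M = M 0 0 • !![(1 : R), 0; 0, 0] + M 0 1 • !![(0 : R), 1; 0, 0] + M 1 0 • !![(0 : R), 0; 1, 0] +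
      M 1 1 • !![(0 : R), 0; 0, 1] := by
  ext i j
  fin_cases i <;> fin_cases j <;>
    simp only [Matrix.add_apply, Matrix.smul_apply,
      Matrix.of_apply, Matrix.cons_val', Matrix.cons_val_zero, Matrix.cons_val_one,
      Matrix.empty_val', Matrix.cons_val_fin_one, Fin.zero_eta, Fin.mk_one, Fin.isValue, smul_eq_mul] <;> ring

/-- The Weyl conjugate has the same trace. [folklore] -/
private theorem mat_trace_weyl_conj (M : Matrix (Fin 2) (Fin 2) R) :
    Matrix.trace !![M 1 1, -M 1 0; -M 0 1, M 0 0] = Matrix.trace M := by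
  rw [Matrix.trace_fin_two, Matrix.trace_fin_two]; simp [add_comm]

/-- The lower-unipotent conjugate has the same trace. [folklore] -/
private theorem mat_trace_lower_conj (M : Matrix (Fin 2) (Fin 2) R) :
    Matrix.trace !![M 0 0 - M 0 1, M 0 1; M 0 0 + M 1 0 - M 0 1 - M 1 1, M 0 1 + M 1 1] =
      Matrix.trace M := by
  rw [Matrix.trace_fin_two, Matrix.trace_fin_two]; simp; ring

end MatrixIdentities2

/-- `2` is a unit of `ℤ_p` for odd `p`. [folklore] -/
private theorem isUnit_two (hp2 : p ≠ 2) : IsUnit (2 : ℤ_[p]) := by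
  have hp : p.Prime := Fact.out
  rw [PadicInt.isUnit_iff]
  have h1 : ‖((2 : ℤ) : ℤ_[p])‖ = 1 := by
    refine le_antisymm (PadicInt.norm_le_one _) (not_lt.mp fun hlt ↦ ?_)
    have hdvd : (p : ℤ) ∣ 2 := (PadicInt.norm_int_lt_one_iff_dvd 2).mp hlt
    have : p ∣ 2 := by exact_mod_cast hdvd
    exact hp2 ((Nat.prime_dvd_prime_iff_eq hp Nat.prime_two).mp this)
  simpa using h1

/-- A unit plus a multiple of `p` is a unit (`ℤ_p` is local). [folklore] -/
private theorem isUnit_add_of_dvd {u z : ℤ_[p]} (hu : IsUnit u) (hz : (p : ℤ_[p]) ∣ z) :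
    IsUnit (u + z) := by
  obtain ⟨y, rfl⟩ := hz
  obtain ⟨v, rfl⟩ := hu
  have h : (v : ℤ_[p]) * (1 + (p : ℤ_[p]) * (↑v⁻¹ * y)) = v + (p : ℤ_[p]) * y := by
    rw [mul_add, mul_one, mul_left_comm, Units.mul_inv_cancel_left]
  rw [← h]
  exact (Units.isUnit v).mul (isUnit_one_add_p_mul p _)

/-- A non-unit of `ℤ_p` is divisible by `p`. [folklore] -/
private theorem dvd_of_not_isUnit {z : ℤ_[p]} (hz : ¬ IsUnit z) : (p : ℤ_[p]) ∣ z := by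
  rw [PadicInt.isUnit_iff] at hz
  exact (PadicInt.norm_lt_one_iff_dvd z).mp (lt_of_le_of_ne (PadicInt.norm_le_one z) hz)

/-- Scaling a first-order element by the inverse of a unit. [folklore] -/
private theorem firstOrder_of_unit_smul {M : Matrix (Fin 2) (Fin 2) ℤ_[p]} {u : ℤ_[p]} (hu : IsUnit u)
    (h : ∃ (τ : absoluteGaloisGroup ℚ) (V : Matrix (Fin 2) (Fin 2) ℤ_[p]),
      LinearMap.toMatrix b b (W.galoisRepTate p τ) = 1 + (p : ℤ_[p]) • (u • M) + ((p : ℤ_[p]) ^ 2) • V) :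
    ∃ (τ : absoluteGaloisGroup ℚ) (V : Matrix (Fin 2) (Fin 2) ℤ_[p]),
      LinearMap.toMatrix b b (W.galoisRepTate p τ) = 1 + (p : ℤ_[p]) • M + ((p : ℤ_[p]) ^ 2) • V := by
  obtain ⟨v, rfl⟩ := hu
  have := firstOrder_smul h (↑v⁻¹ : ℤ_[p])
  rwa [smul_smul (↑v⁻¹ : ℤ_[p]) (↑v : ℤ_[p]) M, Units.inv_mul, one_smul] at this

/-- **Generation, main case.**  `p` odd, `ρ̄_{E,p}` onto, and ONE first-order kernel element `M₀`
whose lower-left entry and whose trace are units: then EVERY matrix is a first-order kernel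
element.  (Conjugating by `(1 ±1; 0 1)` and adding isolates `-2 m₁₀ · e`, so `e = (0 1; 0 0)` is
attained; the Weyl element gives `f`, then `h = diag(1,-1)`; the trace of `M₀` gives the scalars;
`M₂ = ⟨E₁₁, e, f, E₂₂⟩`.)  This is the irreducibility of `sl₂(𝔽_p)` under conjugation plus the
splitting `M₂(𝔽_p) = 𝔽_p ⊕ sl₂(𝔽_p)` (`p` odd), done with explicit matrices — the additive
generation of the trace-zero matrices by conjugates of a nilpotent, as in Serre's proof of the
lifting lemma. [cite: SerreAbelianLadic1968, Ch. IV §3.4, Lemma 3 (IV-23), proof] -/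
theorem firstOrder_all_of_witness_of_isUnit_entry [W.IsElliptic] (hp2 : p ≠ 2)
    (h1 : W.HasSurjectiveModNGaloisRep p) {M₀ : Matrix (Fin 2) (Fin 2) ℤ_[p]}
    (hM₀ : ∃ (τ : absoluteGaloisGroup ℚ) (V : Matrix (Fin 2) (Fin 2) ℤ_[p]),
      LinearMap.toMatrix b b (W.galoisRepTate p τ) = 1 + (p : ℤ_[p]) • M₀ + ((p : ℤ_[p]) ^ 2) • V)
    (h10 : IsUnit (M₀ 1 0)) (htr : IsUnit M₀.trace) (M : Matrix (Fin 2) (Fin 2) ℤ_[p]) :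
    ∃ (τ : absoluteGaloisGroup ℚ) (V : Matrix (Fin 2) (Fin 2) ℤ_[p]),
      LinearMap.toMatrix b b (W.galoisRepTate p τ) = 1 + (p : ℤ_[p]) • M + ((p : ℤ_[p]) ^ 2) • V := by
  have h2 : IsUnit (2 : ℤ_[p]) := isUnit_two hp2
  -- `e`
  have hDp := firstOrder_sub (firstOrder_conj h1 hM₀ _ _ mat_upper_mul_upper') hM₀
  have hDm := firstOrder_sub (firstOrder_conj h1 hM₀ _ _ mat_upper'_mul_upper) hM₀
  rw [mat_upper_conj] at hDp
  rw [mat_upper_conj'] at hDm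
  have he' := firstOrder_add hDp hDm
  rw [mat_upper_conj_add] at he'
  have he : ∃ (τ : absoluteGaloisGroup ℚ) (V : Matrix (Fin 2) (Fin 2) ℤ_[p]),
      LinearMap.toMatrix b b (W.galoisRepTate p τ) =
        1 + (p : ℤ_[p]) • !![(0 : ℤ_[p]), 1; 0, 0] + ((p : ℤ_[p]) ^ 2) • V :=
    firstOrder_of_unit_smul ((h2.mul h10).neg) he'
  -- `f`
  have hf' := firstOrder_conj h1 he _ _ mat_weyl_mul_weyl'
  rw [mat_weyl_conj_e] at hf'
  have hf := firstOrder_neg hf'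
  rw [neg_neg] at hf
  -- `h`
  have hh := firstOrder_add (firstOrder_sub (firstOrder_conj h1 hf _ _ mat_upper_mul_upper') hf) he
  rw [mat_upper_conj_f] at hh
  -- scalars
  have hs' := firstOrder_sub (firstOrder_sub (firstOrder_sub (firstOrder_smul hM₀ 2)
    (firstOrder_smul he (2 * M₀ 0 1))) (firstOrder_smul hf (2 * M₀ 1 0)))
    (firstOrder_smul hh (M₀ 0 0 - M₀ 1 1))
  rw [mat_scalar_part, ← Matrix.trace_fin_two] at hs'
  have hs := firstOrder_of_unit_smul htr hs'
  -- `E₁₁`, `E₂₂`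
  have h11' := firstOrder_add hs hh
  rw [mat_one_add_h] at h11'
  have h11 := firstOrder_of_unit_smul h2 h11'
  have h22' := firstOrder_sub hs hh
  rw [mat_one_sub_h] at h22'
  have h22 := firstOrder_of_unit_smul h2 h22'
  -- any `M`
  rw [mat_eta M]
  exact firstOrder_add (firstOrder_add (firstOrder_add (firstOrder_smul h11 _) (firstOrder_smul he _))
    (firstOrder_smul hf _)) (firstOrder_smul h22 _)

/-- **Generation from a witness that is non-scalar modulo `p` with unit trace.**  "Non-scalar
modulo `p`" is spelled: the lower-left entry, or the upper-right entry, or the difference of the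
diagonal entries is a unit; the last two cases are conjugated into the first by the Weyl element
`(0 1; -1 0)`, resp. by `(1 0; 1 1)`. [cite: SerreAbelianLadic1968, Ch. IV §3.4, Lemma 3 (IV-23), proof] -/
theorem firstOrder_all_of_witness [W.IsElliptic] (hp2 : p ≠ 2)
    (h1 : W.HasSurjectiveModNGaloisRep p) {M₀ : Matrix (Fin 2) (Fin 2) ℤ_[p]}
    (hM₀ : ∃ (τ : absoluteGaloisGroup ℚ) (V : Matrix (Fin 2) (Fin 2) ℤ_[p]),
      LinearMap.toMatrix b b (W.galoisRepTate p τ) = 1 + (p : ℤ_[p]) • M₀ + ((p : ℤ_[p]) ^ 2) • V)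
    (hns : IsUnit (M₀ 1 0) ∨ IsUnit (M₀ 0 1) ∨ IsUnit (M₀ 0 0 - M₀ 1 1)) (htr : IsUnit M₀.trace)
    (M : Matrix (Fin 2) (Fin 2) ℤ_[p]) :
    ∃ (τ : absoluteGaloisGroup ℚ) (V : Matrix (Fin 2) (Fin 2) ℤ_[p]),
      LinearMap.toMatrix b b (W.galoisRepTate p τ) = 1 + (p : ℤ_[p]) • M + ((p : ℤ_[p]) ^ 2) • V := by
  by_cases h10 : IsUnit (M₀ 1 0)
  · exact firstOrder_all_of_witness_of_isUnit_entry hp2 h1 hM₀ h10 htr M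
  by_cases h01 : IsUnit (M₀ 0 1)
  · -- conjugate by the Weyl element
    have hM₀' := firstOrder_conj h1 hM₀ _ _ mat_weyl_mul_weyl'
    rw [mat_weyl_conj] at hM₀'
    refine firstOrder_all_of_witness_of_isUnit_entry hp2 h1 hM₀' ?_ ?_ M
    · simpa using h01.neg
    · rw [mat_trace_weyl_conj]; exact htr
  · -- both off-diagonal entries are divisible by `p`; the diagonal difference is a unit
    have hd : IsUnit (M₀ 0 0 - M₀ 1 1) := by
      rcases hns with h | h | h
      · exact absurd h h10
      · exact absurd h h01
      · exact h
    have hM₀' := firstOrder_conj h1 hM₀ _ _ mat_lower_mul_lower'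
    rw [mat_lower_conj] at hM₀'
    refine firstOrder_all_of_witness_of_isUnit_entry hp2 h1 hM₀' ?_ ?_ M
    · have : M₀ 0 0 + M₀ 1 0 - M₀ 0 1 - M₀ 1 1 = (M₀ 0 0 - M₀ 1 1) + (M₀ 1 0 - M₀ 0 1) := by ring
      simp only [Matrix.of_apply, Matrix.cons_val', Matrix.cons_val_zero, Matrix.cons_val_one,
        Matrix.empty_val', Matrix.cons_val_fin_one]
      rw [this]
      exact isUnit_add_of_dvd hd ((dvd_of_not_isUnit h10).sub (dvd_of_not_isUnit h01))
    · rw [mat_trace_lower_conj]; exact htr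

/-! #### From the matrices back to `E[p^n]`: the tower -/

/-- All first-order elements on matrices ⟹ all first-order elements on `End(T_pE)`. [folklore] -/
private theorem firstOrder_end_of_matrix
    (hall : ∀ M : Matrix (Fin 2) (Fin 2) ℤ_[p], ∃ (τ : absoluteGaloisGroup ℚ)
      (V : Matrix (Fin 2) (Fin 2) ℤ_[p]),
      LinearMap.toMatrix b b (W.galoisRepTate p τ) = 1 + (p : ℤ_[p]) • M + ((p : ℤ_[p]) ^ 2) • V)
    (Z : W.tateModule p →ₗ[ℤ_[p]] W.tateModule p) :
    ∃ (τ : absoluteGaloisGroup ℚ) (V : W.tateModule p →ₗ[ℤ_[p]] W.tateModule p),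
      (W.galoisRepTate p τ : W.tateModule p →ₗ[ℤ_[p]] W.tateModule p) =
        1 + (p : ℤ_[p]) • Z + ((p : ℤ_[p]) ^ 2) • V := by
  obtain ⟨τ, Vm, h⟩ := hall (LinearMap.toMatrix b b Z)
  refine ⟨τ, Matrix.toLin b b Vm, (LinearMap.toMatrix b b).injective ?_⟩
  rw [h, map_add, map_add, map_smul, map_smul, LinearMap.toMatrix_one, LinearMap.toMatrix_toLin]

variable (W p) in
/-- **The tower from surjectivity mod `p` and the first-order kernel elements** (`p` odd): if
`ρ̄_{E,p}` is onto and every `1 + pZ`, `Z ∈ End(T_pE)`, is `≡ ρ(τ) (mod p²)` for some `τ`, then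
`ρ̄_{E,p^n}` is onto for every `n`.  This is the proof of
`forall_hasSurjectiveModNGaloisRep_of_hasSurjectiveModNGaloisRep_sq` with the base level `p²`
replaced by "level `p` + first-order kernel": the kernel elements of every level `k ≥ 1` follow
from those of level `1` by `τ ↦ τ^p` (Serre 1968 IV-23, the inductive step, `p` odd).
[cite: SerreAbelianLadic1968, Ch. IV §3.4, Lemma 3 (IV-23), proof] -/
theorem forall_hasSurjectiveModNGaloisRep_of_hasSurjectiveModNGaloisRep_of_firstOrder [W.IsElliptic]
    (hp2 : p ≠ 2) (h1 : W.HasSurjectiveModNGaloisRep p)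
    (hFO : ∀ Z : W.tateModule p →ₗ[ℤ_[p]] W.tateModule p,
      ∃ (τ : absoluteGaloisGroup ℚ) (V : W.tateModule p →ₗ[ℤ_[p]] W.tateModule p),
        (W.galoisRepTate p τ : W.tateModule p →ₗ[ℤ_[p]] W.tateModule p) =
          1 + (p : ℤ_[p]) • Z + ((p : ℤ_[p]) ^ 2) • V)
    (n : ℕ) : W.HasSurjectiveModNGaloisRep (p ^ n : ℕ) := by
  have hp : p.Prime := Fact.out
  have hp3 : 2 < p := lt_of_le_of_ne hp.two_le (Ne.symm hp2)
  set T := W.tateModule p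
  set ρ := W.galoisRepTate p with hρ
  have h1' : W.HasSurjectiveModNGaloisRep (p ^ 1 : ℕ) := by rwa [pow_one]
  -- (b) kernel elements of every level `k ≥ 1`
  have hker : ∀ k : ℕ, 1 ≤ k → ∀ Z : T →ₗ[ℤ_[p]] T,
      ∃ τ : absoluteGaloisGroup ℚ, ∃ V : T →ₗ[ℤ_[p]] T,
        (ρ τ : T →ₗ[ℤ_[p]] T) = 1 + ((p : ℤ_[p]) ^ k) • Z + ((p : ℤ_[p]) ^ (k + 1)) • V := by
    intro k hk
    induction k, hk using Nat.le_induction with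
    | base => intro Z; simpa only [pow_one] using hFO Z
    | succ k hk ih =>
      intro Z
      obtain ⟨τ, V, hτ⟩ := ih Z
      obtain ⟨V', hV'⟩ := Serre1968.exists_pow_eq_one_add_of_one_le
        (R := ℤ_[p]) (A := T →ₗ[ℤ_[p]] T) hp hp3 hk Z V
      exact ⟨τ ^ p, V', by rw [map_pow, hτ, hV']⟩
  -- (c) every `B` with unit determinant is `≡ ρ(σ) (mod p^k)`, for every `k ≥ 1`
  have key : ∀ k : ℕ, 1 ≤ k → ∀ B : T →ₗ[ℤ_[p]] T, IsUnit (LinearMap.det B) →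
      ∃ σ : absoluteGaloisGroup ℚ, ∃ C : T →ₗ[ℤ_[p]] T,
        (ρ σ : T →ₗ[ℤ_[p]] T) = B + ((p : ℤ_[p]) ^ k) • C := by
    intro k hk
    induction k, hk using Nat.le_induction with
    | base =>
      intro B hB
      exact exists_galoisRepTate_eq_add_smul_of_hasSurjectiveModNGaloisRep W p h1' B hB
    | succ k hk ih =>
      intro B hB
      obtain ⟨σ, C, hσ⟩ := ih B hB
      have hinv : ρ σ⁻¹ * ρ σ = 1 := by rw [← map_mul, inv_mul_cancel, map_one]
      set Z : T →ₗ[ℤ_[p]] T := -(C * ρ σ⁻¹) with hZ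
      obtain ⟨τ, V, hτ⟩ := hker k hk Z
      refine ⟨τ * σ, V * ρ σ, ?_⟩
      have hB' : B = ρ σ - ((p : ℤ_[p]) ^ k) • C := by rw [hσ]; abel
      rw [map_mul, hτ, hB', hZ, add_mul, add_mul, one_mul, smul_mul_assoc, smul_mul_assoc, neg_mul,
        mul_assoc, hinv, mul_one, pow_succ, mul_smul, smul_neg]
      abel
  -- (d) back to `E[p^n]`
  intro φm
  rcases Nat.eq_zero_or_pos n with rfl | hn
  · have h0 : ∀ z : geomTorsion W ((p ^ 0 : ℕ) : ℤ), (z : geomPoints W) = 0 := by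
      intro z
      have hz : ((p ^ 0 : ℕ) : ℤ) • (z : geomPoints W) = 0 :=
        (Submodule.mem_torsionBy_iff (R := ℤ) _ _).mp z.2
      change ((1 : ℕ) : ℤ) • (z : geomPoints W) = 0 at hz
      rwa [Nat.cast_one, one_smul] at hz
    haveI : Subsingleton (geomTorsion W ((p ^ 0 : ℕ) : ℤ)) :=
      ⟨fun x y => Subtype.ext (by rw [h0 x, h0 y])⟩
    refine ⟨1, ?_⟩
    apply Multiplicative.toAdd.injective
    ext P
    exact congrArg Subtype.val (Subsingleton.elim _ _)
  set φ : geomTorsion W (p ^ n : ℕ) ≃+ geomTorsion W (p ^ n : ℕ) := Multiplicative.toAdd φm with hφ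
  have hmem : ∀ (n : ℕ) (a : T), TateModule.proj p n a ∈ geomTorsion W (p ^ n : ℕ) :=
    fun n a => proj_tateModule_mem_geomTorsion W p n a
  obtain ⟨A, hA⟩ := exists_linearMap_proj_eq W p n φ.toAddMonoidHom
  obtain ⟨A', hA'⟩ := exists_linearMap_proj_eq W p n φ.symm.toAddMonoidHom
  have hAu : IsUnit (LinearMap.det A) :=
    isUnit_det_of_proj_eq W p hn φ A A' (fun t => hA t) (fun t => hA' t)
  obtain ⟨σ, C, hσ⟩ := key n hn A hAu
  refine ⟨σ, ?_⟩
  apply Multiplicative.toAdd.injective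
  rw [← hφ]
  refine AddEquiv.ext fun P => Subtype.ext ?_
  obtain ⟨t, ht⟩ := proj_surjective_of_isAlgClosed_holds W p n P.2
  have hP : P = ⟨TateModule.proj p n t, hmem n t⟩ := Subtype.ext ht.symm
  have h1 : ((Multiplicative.toAdd (galoisRepTorsion W _ σ)) P : geomPoints W) =
      σ • (P : geomPoints W) := rfl
  rw [h1, hP]
  change σ • TateModule.proj p n t = ((φ.toAddMonoidHom ⟨TateModule.proj p n t, hmem n t⟩ :
    geomTorsion W (p ^ n : ℕ)) : geomPoints W)
  have hσt : TateModule.proj p n (ρ σ t) = TateModule.proj p n (A t) := by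
    rw [hσ, LinearMap.add_apply, LinearMap.smul_apply, map_add, TateModule.proj_pow_smul,
      TateModule.pow_smul_proj, add_zero]
  rw [← hA t, ← hσt, hρ, galoisRepTate_apply_apply, TateModule.proj_smul_of_distribMulAction]

/-- **ONE first-order witness ⟹ the tower** (`p` odd).  Let `E = W/ℚ` be an elliptic curve with
`ρ̄_{E,p}` onto, `b` a `ℤ_p`-basis of `T_pE`, and suppose some `τ ∈ Γ_ℚ` has matrix
`1 + p M₀ + p² V` with `M₀ mod p` NOT scalar (a unit among `m₁₀, m₀₁, m₀₀ - m₁₁`) and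
`tr M₀ ∈ ℤ_pˣ`.  Then `ρ̄_{E,p^n}` is onto for every `n`, i.e. `ρ_{E,p^∞}(Γ_ℚ) = GL₂(ℤ_p)`.
Group theory: the image `G` of `ρ̄_{E,p²}` maps onto `GL₂(𝔽_p)` and meets the kernel
`1 + p M₂(𝔽_p) ≅ (M₂(𝔽_p), +)` in a subgroup stable under conjugation by `GL₂(𝔽_p)`; the only such
subgroups are `0`, the scalars, `sl₂(𝔽_p)` and `M₂(𝔽_p)` (`p` odd: `M₂ = 𝔽_p ⊕ sl₂`, `sl₂`
irreducible), and an element that is neither scalar nor traceless generates everything; so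
`G ⊇ ker` and `G = GL₂(ℤ/p²)`, whence the tower by Serre's lemma (IV-23).  At `p = 3` this is the
finite certificate replacing the (false in general) lifting "surj(3) ⟹ surj(9)" (Serre noted
that `SL₂(ℤ/9) → SL₂(𝔽₃)` has a section; Elkies 2006, Introduction and §1); at `p ≥ 5` surj(p) alone suffices (`serre_hasSurjectiveModNGaloisRep_pow`).
[cite: SerreAbelianLadic1968, Ch. IV §3.4, Lemma 3 (IV-23)] [cite: Elkies2006, Introduction (p. 1) and §1] -/
theorem forall_hasSurjectiveModNGaloisRep_of_firstOrderWitness [W.IsElliptic] (hp2 : p ≠ 2)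
    (h1 : W.HasSurjectiveModNGaloisRep p) (b : Module.Basis (Fin 2) ℤ_[p] (W.tateModule p))
    (M₀ : Matrix (Fin 2) (Fin 2) ℤ_[p])
    (hM₀ : ∃ (τ : absoluteGaloisGroup ℚ) (V : Matrix (Fin 2) (Fin 2) ℤ_[p]),
      LinearMap.toMatrix b b (W.galoisRepTate p τ) = 1 + (p : ℤ_[p]) • M₀ + ((p : ℤ_[p]) ^ 2) • V)
    (hns : IsUnit (M₀ 1 0) ∨ IsUnit (M₀ 0 1) ∨ IsUnit (M₀ 0 0 - M₀ 1 1)) (htr : IsUnit M₀.trace)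
    (n : ℕ) : W.HasSurjectiveModNGaloisRep (p ^ n : ℕ) :=
  forall_hasSurjectiveModNGaloisRep_of_hasSurjectiveModNGaloisRep_of_firstOrder W p hp2 h1
    (firstOrder_end_of_matrix (firstOrder_all_of_witness hp2 h1 hM₀ hns htr)) n

end FirstOrder

end WeierstrassCurve

namespace Literature.NumberTheory.EllipticCurves

namespace Kato2004

open WeierstrassCurve Literature.NumberTheory.GaloisRepresentations

/-- **Kato's (12.5.2) from ONE first-order witness** (`p` odd): surjectivity of `ρ̄_{E,p}` and a
`τ ∈ Γ_ℚ` acting on `T_pE` as `1 + p M₀ + p² V` with `M₀ mod p` non-scalar and `tr M₀ ∈ ℤ_pˣ` give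
(12.5.2) for `T_pE`. [cite: Kato2004Asterisque, (12.5.2) in Thm. 12.5 (4) (p. 222)]
[cite: SerreAbelianLadic1968, Ch. IV §3.4, Lemma 3 (IV-23)] -/
theorem imageContainsSL2_of_firstOrderWitness (W : WeierstrassCurve ℚ) [W.IsElliptic] (p : ℕ)
    [Fact p.Prime] (hp2 : p ≠ 2) (h1 : W.HasSurjectiveModNGaloisRep p)
    (b : Module.Basis (Fin 2) ℤ_[p] (W.tateModule p)) (M₀ : Matrix (Fin 2) (Fin 2) ℤ_[p])
    (hM₀ : ∃ (τ : absoluteGaloisGroup ℚ) (V : Matrix (Fin 2) (Fin 2) ℤ_[p]),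
      LinearMap.toMatrix b b (W.galoisRepTate p τ) = 1 + (p : ℤ_[p]) • M₀ + ((p : ℤ_[p]) ^ 2) • V)
    (hns : IsUnit (M₀ 1 0) ∨ IsUnit (M₀ 0 1) ∨ IsUnit (M₀ 0 0 - M₀ 1 1)) (htr : IsUnit M₀.trace) :
    ImageContainsSL2 W p :=
  imageContainsSL2_of_forall_hasSurjectiveModNGaloisRep W p
    (forall_hasSurjectiveModNGaloisRep_of_firstOrderWitness hp2 h1 b M₀ hM₀ hns htr)

end Kato2004

end Literature.NumberTheory.EllipticCurves

end
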